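import Literature.Probability.RandomPlanarGeometry.ConformalMap
import Literature.Topology.PlaneTopology.JordanCurve
import Literature.Topology.PlaneTopology.Crosscut
import Literature.Analysis.Complex.BoundaryUniqueness
import Literature.Analysis.Complex.LengthArea
import HarnessLib

/-!
# Carathéodory's extension theorem for Jordan domains, from the Jordan curve theorem

Trunk T-STOCH (complex analysis / plane topology). The disc form of **Carathéodory's theorem**
is vendored in `Literature/Probability/RandomPlanarGeometry/ConformalMap.lean` as the named fact
`Literature.Probability.RandomPlanarGeometry.JordanDomain.exists_continuousOn_extension` (Pommerenke, *Boundary Behaviour of Conformal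
Maps* (1992), Thm. 2.6): a conformal equivalence `φ` of the unit disc `𝔻` onto a Jordan domain
`D` extends continuously to the closed disc, the extension being a bijection
`closedBall 0 1 → closure D` mapping the unit circle bijectively onto `∂D`. This file **proves**
it from the Jordan curve theorem, itself vendored as the named fact `Literature.Topology.PlaneTopology.JordanCurveTheorem`
(`Literature/Topology/PlaneTopology/JordanCurve.lean`, McCleary (2006), Ch. 9):

* `Literature.JordanDomain.exists_continuousOn_extension_of_jordanCurveTheorem :
    JordanCurveTheorem → JordanDomain.exists_continuousOn_extension`.

The proof is the classical one (Pommerenke (1992), §2.1–2.3; Garnett–Marshall, *Harmonic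
Measure* (2005), Thm. I.3.1), with the analysis supplied by
`Literature/Analysis/Complex/LengthArea.lean` (the length–area lemma: short crosscuts
`φ (𝔻 ∩ {|w - ζ| = r})` with endpoints `a, b ∈ ∂D`, `Literature.Analysis.Complex.LengthArea.exists_short_crosscut`) and
`Literature/Analysis/Complex/BoundaryUniqueness.lean` (a function holomorphic in the disc,
continuous on the closed disc and vanishing on an arc vanishes identically):

1. *Plane topology of the Jordan domain* (`JordanDomain.isConnected_compl_closure`): by the
   Jordan curve theorem applied to `∂D`, the domain `D` is one complementary component of `∂D`
   and the exterior `ℂ ∖ D̄` is the other: connected, unbounded, with frontier `∂D`.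
2. *Short boundary arcs* (`JordanDomain.exists_short_arc`): boundary points close in `ℂ` are
   joined by a boundary arc of small diameter (compactness: the boundary loop `ℝ/ℤ → ∂D` is a
   homeomorphism; `JordanDomain.boundary_fract`, `JordanDomain.injOn_boundary_Ico` come from
   `Literature/Topology/PlaneTopology/Crosscut.lean`).
3. *The crosscut loop* (`JordanDomain.exists_loop`): a short crosscut closed up by the short
   boundary arc between its endpoints is a Jordan curve `E` (gluing lemmas
   `exists_periodic_of_closed_arc`, `exists_periodic_of_two_arcs`), of small diameter.
4. *Sides of the crosscut* (`JordanDomain.image_inter_ball_subset`): the images `W₁`, `W₂` of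
   `𝔻 ∩ {|w - ζ| < r}` and `𝔻 ∩ {|w - ζ| > r}` (the latter preconnected,
   `isPreconnected_ball_diff_closedBall`) miss `E` and lie in different complementary components
   of `E`, since an interior point of the crosscut is a frontier point of both components and its
   nearby points off `E` are in `W₁ ∪ W₂`; the far side contains `φ 0`, far from `E`, so the near
   side lies in the bounded component, inside a small disc (`subset_closedBall_of_isBounded`).
5. *Continuity* (`JordanDomain.exists_forall_dist_lt`, `continuousOn_extendFrom`): hence `φ`
   oscillates little near each `ζ ∈ ∂𝔻`, has limits, and `extendFrom 𝔻 φ` is continuous on the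
   closed disc; it maps the closed disc onto `D̄` and the circle onto `∂D` (compactness).
6. *Injectivity on the circle* (`JordanDomain.injOn_extendFrom_sphere`): if two points of the
   circle had the same image `w`, the images of the two radii would form a Jordan curve `E'`
   through `w`; one of the two sectors of the disc is mapped into the bounded component of
   `ℂ ∖ E'` (same frontier argument), whose closure meets `∂D` only at `w` (the exterior of `D`
   is connected and unbounded, so lies in the unbounded component, and accumulates at every
   point of `∂D`); so the extension is constantly `w` on an arc of the circle, and boundary
   uniqueness gives `φ ≡ w`, absurd.

Everything in this file is proved; the only input beyond Mathlib and the two analytic files is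
the hypothesis `JordanCurveTheorem`.

## References

* Ch. Pommerenke, *Boundary Behaviour of Conformal Maps*, Springer (1992), Thm. 2.6, §2.1–2.3.
* J. B. Garnett, D. E. Marshall, *Harmonic Measure*, CUP (2005), Thm. I.3.1.
* J. McCleary, *A First Course in Topology: Continuity and Dimension*, AMS (2006), Ch. 9
  (the Jordan curve theorem, as vendored).
-/

noncomputable section

open Set Filter Metric Topology Complex Real
open scoped NNReal

namespace Literature.Probability.RandomPlanarGeometry

/-! ### Gluing arcs into Jordan curves -/

section Gluing

/-- A closed arc `p : [0, 1] → ℂ` (continuous, injective on `[0, 1)`, `p 0 = p 1`) is the range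
of a continuous `1`-periodic map injective on a period, namely `p ∘ fract`. [folklore] -/
theorem exists_periodic_of_closed_arc {p : ℝ → ℂ} (hp : ContinuousOn p (Icc 0 1))
    (hinj : InjOn p (Ico 0 1)) (h01 : p 0 = p 1) :
    ∃ γ : ℝ → ℂ, Continuous γ ∧ γ.Periodic 1 ∧ InjOn γ (Ico 0 1) ∧ range γ = p '' Icc 0 1 := by
  refine ⟨p ∘ Int.fract, hp.comp_fract'' h01, fun x ↦ by simp, ?_, ?_⟩
  · intro x hx y hy hxy
    simp only [Function.comp_apply, Int.fract_eq_self.2 hx, Int.fract_eq_self.2 hy] at hxy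
    exact hinj hx hy hxy
  · ext z
    constructor
    · rintro ⟨x, rfl⟩
      exact ⟨Int.fract x, ⟨Int.fract_nonneg x, (Int.fract_lt_one x).le⟩, rfl⟩
    · rintro ⟨t, ht, rfl⟩
      rcases eq_or_lt_of_le ht.2 with rfl | h1
      · exact ⟨0, by simp [h01]⟩
      · exact ⟨t, by simp [Int.fract_eq_self.2 ⟨ht.1, h1⟩]⟩

/-- The concatenation of two arcs `p, q : [0, 1] → ℂ`. [folklore] -/
def concatArc (p q : ℝ → ℂ) (t : ℝ) : ℂ := if t ≤ 1 / 2 then p (2 * t) else q (2 * t - 1)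

variable {p q : ℝ → ℂ} {t : ℝ}

/-- The first half of the concatenation runs through `p`. [folklore] -/
theorem concatArc_of_le (h : t ≤ 1 / 2) : concatArc p q t = p (2 * t) := if_pos h

/-- The second half of the concatenation runs through `q`. [folklore] -/
theorem concatArc_of_gt (h : 1 / 2 < t) : concatArc p q t = q (2 * t - 1) := if_neg (not_le.2 h)

/-- The concatenation of two continuous arcs with `p 1 = q 0` is continuous on `[0, 1]`. [folklore] -/
theorem continuousOn_concatArc (hp : ContinuousOn p (Icc 0 1)) (hq : ContinuousOn q (Icc 0 1))
    (h1 : p 1 = q 0) : ContinuousOn (concatArc p q) (Icc 0 1) := by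
  have hI : Icc (0 : ℝ) 1 = Icc 0 (1 / 2) ∪ Icc (1 / 2) 1 := by
    rw [Icc_union_Icc_eq_Icc] <;> norm_num
  rw [hI]
  refine ContinuousOn.union_of_isClosed ?_ ?_ isClosed_Icc isClosed_Icc
  · have h : ContinuousOn (fun t ↦ p (2 * t)) (Icc 0 (1 / 2)) :=
      hp.comp (by fun_prop) fun t ht ↦ ⟨by linarith [ht.1], by linarith [ht.2]⟩
    exact h.congr fun t ht ↦ concatArc_of_le ht.2
  · have h : ContinuousOn (fun t ↦ q (2 * t - 1)) (Icc (1 / 2) 1) :=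
      hq.comp (by fun_prop) fun t ht ↦ ⟨by linarith [ht.1], by linarith [ht.2]⟩
    refine h.congr fun t ht ↦ ?_
    rcases eq_or_lt_of_le ht.1 with rfl | hlt
    · rw [concatArc_of_le le_rfl]; norm_num [h1]
    · exact concatArc_of_gt hlt

/-- The concatenation traces exactly the union of the two arcs. [folklore] -/
theorem concatArc_image_Icc (h1 : p 1 = q 0) :
    concatArc p q '' Icc 0 1 = p '' Icc 0 1 ∪ q '' Icc 0 1 := by
  ext z
  simp only [mem_image, mem_union]
  constructor
  · rintro ⟨t, ht, rfl⟩
    by_cases h : t ≤ 1 / 2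
    · exact Or.inl ⟨2 * t, ⟨by linarith [ht.1], by linarith⟩, (concatArc_of_le h).symm⟩
    · exact Or.inr ⟨2 * t - 1, ⟨by linarith [not_le.1 h], by linarith [ht.2]⟩,
        (concatArc_of_gt (not_le.1 h)).symm⟩
  · rintro (⟨s, hs, rfl⟩ | ⟨s, hs, rfl⟩)
    · refine ⟨s / 2, ⟨by linarith [hs.1], by linarith [hs.2]⟩, ?_⟩
      rw [concatArc_of_le (by linarith [hs.2])]; ring_nf
    · rcases eq_or_lt_of_le hs.1 with rfl | hpos
      · exact ⟨1 / 2, ⟨by norm_num, by norm_num⟩, by rw [concatArc_of_le le_rfl]; norm_num [h1]⟩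
      · refine ⟨(s + 1) / 2, ⟨by linarith, by linarith [hs.2]⟩, ?_⟩
        rw [concatArc_of_gt (by linarith)]; ring_nf

/-- **Two arcs meeting only at their endpoints form a Jordan curve.** If `p, q : [0, 1] → ℂ`
are continuous injective arcs with `p 1 = q 0`, `q 1 = p 0`, and no interior point of `q`
lies on `p`, then `p [0,1] ∪ q [0,1]` is the range of a continuous `1`-periodic
map injective on a period. [folklore] -/
theorem exists_periodic_of_two_arcs (hp : ContinuousOn p (Icc 0 1)) (hq : ContinuousOn q (Icc 0 1))
    (hpi : InjOn p (Icc 0 1)) (hqi : InjOn q (Icc 0 1)) (h1 : p 1 = q 0) (h2 : q 1 = p 0)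
    (hqp : ∀ s ∈ Ioo (0 : ℝ) 1, ∀ s' ∈ Icc (0 : ℝ) 1, q s ≠ p s') :
    ∃ γ : ℝ → ℂ, Continuous γ ∧ γ.Periodic 1 ∧ InjOn γ (Ico 0 1) ∧
      range γ = p '' Icc 0 1 ∪ q '' Icc 0 1 := by
  have h01 : concatArc p q 0 = concatArc p q 1 := by
    rw [concatArc_of_le (by norm_num), concatArc_of_gt (by norm_num)]
    norm_num [h2]
  -- injectivity of the concatenation on `[0, 1)`
  have hinj : InjOn (concatArc p q) (Ico 0 1) := by
    intro x hx y hy hxy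
    by_cases hxl : x ≤ 1 / 2 <;> by_cases hyl : y ≤ 1 / 2
    · rw [concatArc_of_le hxl, concatArc_of_le hyl] at hxy
      have := hpi ⟨by linarith [hx.1], by linarith⟩ ⟨by linarith [hy.1], by linarith⟩ hxy
      linarith
    · rw [concatArc_of_le hxl, concatArc_of_gt (not_le.1 hyl)] at hxy
      -- `p (2x) = q (2y - 1)` with `2y - 1 ∈ (0, 1)`: contradiction
      exact absurd hxy.symm (hqp _ ⟨by linarith [not_le.1 hyl], by linarith [hy.2]⟩ _
        ⟨by linarith [hx.1], by linarith⟩)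
    · rw [concatArc_of_gt (not_le.1 hxl), concatArc_of_le hyl] at hxy
      exact absurd hxy (hqp _ ⟨by linarith [not_le.1 hxl], by linarith [hx.2]⟩ _
        ⟨by linarith [hy.1], by linarith⟩)
    · rw [concatArc_of_gt (not_le.1 hxl), concatArc_of_gt (not_le.1 hyl)] at hxy
      have := hqi ⟨by linarith [not_le.1 hxl], by linarith [hx.2]⟩
        ⟨by linarith [not_le.1 hyl], by linarith [hy.2]⟩ hxy
      linarith
  obtain ⟨γ, hγc, hγp, hγi, hγr⟩ :=
    exists_periodic_of_closed_arc (continuousOn_concatArc hp hq h1) hinj h01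
  exact ⟨γ, hγc, hγp, hγi, by rw [hγr, concatArc_image_Icc h1]⟩

end Gluing

/-! ### Jordan domains: boundary parametrisation, exterior, short boundary arcs -/

namespace JordanDomain

variable (D : JordanDomain)

/-- The frontier of a Jordan domain is the range of its boundary loop. [folklore] -/
theorem frontier_eq_range : frontier D.carrier = range D.boundary := D.range_boundary.symm

/-- Boundary points of a Jordan domain are not in the (open) domain. [folklore] -/
theorem not_mem_of_mem_frontier {z : ℂ} (hz : z ∈ frontier D.carrier) : z ∉ D.carrier :=
  fun h ↦ (D.isOpen.inter_frontier_eq ▸ ⟨h, hz⟩ : z ∈ (∅ : Set ℂ))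

/-- The closure of a Jordan domain is the domain together with its frontier. [folklore] -/
theorem closure_eq_union : closure D.carrier = D.carrier ∪ frontier D.carrier := by
  rw [closure_eq_interior_union_frontier, D.isOpen.interior_eq]

/-- The closure of a Jordan domain is compact. [folklore] -/
theorem isCompact_closure : IsCompact (closure D.carrier) := D.isBounded.isCompact_closure

/-- The boundary loop is injective on every closed interval of length less than one. [folklore] -/
theorem injOn_boundary_uIcc {u v : ℝ} (h : |u - v| < 1) : InjOn D.boundary (uIcc u v) := by
  have hsub : uIcc u v ⊆ Ico (min u v) (min u v + 1) := by
    intro s hs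
    rw [uIcc, mem_Icc] at hs
    refine ⟨hs.1, ?_⟩
    rcases le_total u v with huv | huv
    · rw [min_eq_left huv]; rw [max_eq_right huv] at hs
      have := (abs_sub_lt_iff.1 h).2; linarith [hs.2]
    · rw [min_eq_right huv]; rw [max_eq_left huv] at hs
      have := (abs_sub_lt_iff.1 h).1; linarith [hs.2]
  exact (D.injOn_boundary_Ico (min u v)).mono hsub

/-- **The exterior of a Jordan domain** (from the Jordan curve theorem): the complement of the
closure of a Jordan domain `D` is connected, and its frontier is `∂D`. Proof: `D` is open,
connected and disjoint from `∂D`, hence one of the two complementary components of the Jordan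
curve `∂D`, indeed equal to it (a connected open set meeting `D` but not `∂D` cannot leave
`D̄`); the other component is `ℂ ∖ D̄`. [folklore] -/
theorem isConnected_compl_closure (hJ : Literature.Topology.PlaneTopology.JordanCurveTheorem) :
    IsConnected (closure D.carrier)ᶜ ∧ frontier (closure D.carrier)ᶜ = frontier D.carrier := by
  obtain ⟨U, V, hUo, hVo, hUc, hVc, hUV, hunion, hfU, hfV, -, -⟩ :=
    hJ.of_periodic D.continuous_boundary D.periodic_boundary D.injOn_boundary
  rw [← D.frontier_eq_range] at hunion hfU hfV
  set Ω := D.carrier with hΩ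
  set J := frontier D.carrier with hJdef
  have hΩJ : Ω ⊆ Jᶜ := fun z hz hzJ ↦ D.not_mem_of_mem_frontier hzJ hz
  -- a connected open set containing `Ω` and missing `J` is `Ω`
  have key : ∀ W : Set ℂ, IsOpen W → IsPreconnected W → W ⊆ Jᶜ → Ω ⊆ W → W = Ω := by
    intro W hWo hWc hWJ hΩW
    refine Subset.antisymm ?_ hΩW
    have hcov : W ⊆ Ω ∪ (closure Ω)ᶜ := by
      intro x hx
      by_cases hxΩ : x ∈ Ω
      · exact Or.inl hxΩ
      · refine Or.inr fun hxc ↦ ?_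
        rw [D.closure_eq_union] at hxc
        exact hxc.elim hxΩ (hWJ hx)
    have hdisj : Disjoint Ω (closure Ω)ᶜ :=
      disjoint_compl_right.mono_left subset_closure
    rcases hWc.subset_or_subset D.isOpen isClosed_closure.isOpen_compl hdisj hcov with h | h
    · exact h
    · obtain ⟨x, hx⟩ := D.isConnected.nonempty
      exact absurd (subset_closure hx) (h (hΩW hx))
  have hΩUV : Ω ⊆ U ∪ V := hunion ▸ hΩJ
  -- the component containing `Ω` is `Ω`, the other one is the exterior
  have finish : ∀ U V : Set ℂ, IsOpen U → IsPreconnected U → IsConnected V → Disjoint U V →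
      U ∪ V = Jᶜ → frontier V = J → Ω ⊆ U →
      IsConnected (closure Ω)ᶜ ∧ frontier (closure Ω)ᶜ = J := by
    intro U V hUo hUc hVc hUV hunion hfV hΩU
    have hUΩ : U = Ω := key U hUo hUc (hunion ▸ subset_union_left) hΩU
    have hV : V = (closure Ω)ᶜ := by
      rw [D.closure_eq_union, ← hΩ, ← hJdef, ← hUΩ, compl_union]
      ext x
      constructor
      · intro hx
        exact ⟨fun hxU ↦ Set.disjoint_left.1 hUV hxU hx, (hunion.le (Or.inr hx) : x ∈ Jᶜ)⟩
      · rintro ⟨hxU, hxJ⟩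
        rcases (hunion.ge hxJ : x ∈ U ∪ V) with h | h
        · exact absurd h hxU
        · exact h
    rw [← hV]
    exact ⟨hVc, hfV⟩
  rcases D.isConnected.isPreconnected.subset_or_subset hUo hVo hUV hΩUV with h | h
  · exact finish U V hUo hUc.isPreconnected hVc hUV hunion hfV h
  · exact finish V U hVo hVc.isPreconnected hUc hUV.symm (union_comm U V ▸ hunion) hfU h

/-- The exterior of a Jordan domain is unbounded. [folklore] -/
theorem not_isBounded_compl_closure : ¬ Bornology.IsBounded (closure D.carrier)ᶜ := by
  intro h
  have := h.union D.isCompact_closure.isBounded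
  rw [compl_union_self] at this
  exact NormedSpace.unbounded_univ ℂ ℂ this

/-- Uniform continuity of the boundary loop (continuous and periodic). [folklore] -/
theorem exists_dist_boundary_lt {η : ℝ} (hη : 0 < η) :
    ∃ θ > 0, ∀ s s' : ℝ, |s - s'| < θ → dist (D.boundary s) (D.boundary s') < η := by
  have huc := (isCompact_Icc (a := (-1 : ℝ)) (b := 2)).uniformContinuousOn_of_continuous
    D.continuous_boundary.continuousOn
  obtain ⟨θ₀, hθ₀, h⟩ := Metric.uniformContinuousOn_iff.1 huc η hη
  refine ⟨min θ₀ 1, lt_min hθ₀ one_pos, fun s s' hss' ↦ ?_⟩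
  have h1 : |s - s'| < θ₀ := hss'.trans_le (min_le_left _ _)
  have h2 : |s - s'| < 1 := hss'.trans_le (min_le_right _ _)
  set n : ℤ := ⌊s⌋ with hn
  have hs : D.boundary s = D.boundary (s - n) := by
    rw [← D.periodic_boundary.sub_int_mul_eq n (x := s), mul_one]
  have hs' : D.boundary s' = D.boundary (s' - n) := by
    rw [← D.periodic_boundary.sub_int_mul_eq n (x := s'), mul_one]
  rw [hs, hs']
  have hfl := Int.floor_le s
  have hfl' := Int.lt_floor_add_one s
  refine h (s - n) ⟨by linarith, by linarith⟩ (s' - n) ⟨?_, ?_⟩ ?_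
  · have := (abs_sub_lt_iff.1 h2).1; linarith
  · have := (abs_sub_lt_iff.1 h2).2; linarith
  · rwa [Real.dist_eq, sub_sub_sub_cancel_right]

/-- Points of the boundary loop that are close in `ℂ` have close parameters modulo `1`
(the inverse of the continuous bijection `ℝ/ℤ → ∂D` is uniformly continuous). [folklore] -/
theorem exists_abs_sub_lt_or {θ : ℝ} (hθ : 0 < θ) :
    ∃ ε > 0, ∀ u ∈ Icc (0 : ℝ) 1, ∀ v ∈ Icc (0 : ℝ) 1,
      dist (D.boundary u) (D.boundary v) < ε → |u - v| < θ ∨ 1 - θ < |u - v| := by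
  set K : Set (ℝ × ℝ) := {x | x ∈ Icc (0 : ℝ) 1 ×ˢ Icc (0 : ℝ) 1 ∧ θ ≤ |x.1 - x.2| ∧
    |x.1 - x.2| ≤ 1 - θ} with hK
  have hKc : IsCompact K := by
    refine (isCompact_Icc.prod isCompact_Icc).of_isClosed_subset ?_ fun x hx ↦ hx.1
    refine (isClosed_Icc.prod isClosed_Icc).inter (IsClosed.inter ?_ ?_)
    · exact isClosed_le continuous_const (continuous_fst.sub continuous_snd).abs
    · exact isClosed_le (continuous_fst.sub continuous_snd).abs continuous_const
  set F : ℝ × ℝ → ℝ := fun x ↦ dist (D.boundary x.1) (D.boundary x.2) with hF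
  have hFc : Continuous F := by
    have := D.continuous_boundary; fun_prop
  -- `F` does not vanish on `K`
  have hFpos : ∀ x ∈ K, 0 < F x := by
    rintro ⟨u, v⟩ ⟨⟨hu, hv⟩, h1, h2⟩
    refine dist_pos.2 fun heq ↦ ?_
    simp only at h1 h2 hu hv heq
    have hper : D.boundary 1 = D.boundary 0 := by
      have := D.periodic_boundary 0; rwa [zero_add] at this
    rcases eq_or_lt_of_le hu.2 with rfl | hu1 <;> rcases eq_or_lt_of_le hv.2 with rfl | hv1
    · simp at h1; linarith
    · rw [hper] at heq
      have := D.injOn_boundary ⟨le_rfl, one_pos⟩ ⟨hv.1, hv1⟩ heq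
      subst this; simp at h2; linarith
    · rw [hper] at heq
      have := D.injOn_boundary ⟨hu.1, hu1⟩ ⟨le_rfl, one_pos⟩ heq
      subst this; simp at h2; linarith
    · have := D.injOn_boundary ⟨hu.1, hu1⟩ ⟨hv.1, hv1⟩ heq
      subst this; simp at h1; linarith
  rcases K.eq_empty_or_nonempty with hKe | hKne
  · refine ⟨1, one_pos, fun u hu v hv _ ↦ ?_⟩
    by_contra hcon
    have : (u, v) ∈ K := ⟨⟨hu, hv⟩, by push Not at hcon; exact hcon.1, by push Not at hcon; exact hcon.2⟩
    rw [hKe] at this; exact this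
  · obtain ⟨x₀, hx₀, hmin⟩ := hKc.exists_isMinOn hKne hFc.continuousOn
    refine ⟨F x₀, hFpos x₀ hx₀, fun u hu v hv hlt ↦ ?_⟩
    by_contra hcon
    have hmem : (u, v) ∈ K :=
      ⟨⟨hu, hv⟩, by push Not at hcon; exact hcon.1, by push Not at hcon; exact hcon.2⟩
    exact absurd (hmin hmem) (not_le.2 hlt)

/-- **Short boundary arcs.** For every `η > 0` there is `ε > 0` such that any two boundary
points `a, b` of the Jordan domain at distance `< ε` are joined by a boundary arc
`D.boundary [u, v]` (`|u - v| < 1/2`) all of whose points are within `η` of `a`. [folklore] -/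
theorem exists_short_arc {η : ℝ} (hη : 0 < η) :
    ∃ ε > 0, ∀ a ∈ frontier D.carrier, ∀ b ∈ frontier D.carrier, dist a b < ε →
      ∃ u v : ℝ, D.boundary u = a ∧ D.boundary v = b ∧ |u - v| < 1 / 2 ∧
        ∀ s ∈ uIcc u v, dist (D.boundary s) a < η := by
  obtain ⟨θ₀, hθ₀, hmod⟩ := D.exists_dist_boundary_lt hη
  set θ := min θ₀ (1 / 2) with hθ
  have hθpos : 0 < θ := lt_min hθ₀ (by norm_num)
  obtain ⟨ε, hε, hclose⟩ := D.exists_abs_sub_lt_or hθpos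
  refine ⟨ε, hε, fun a ha b hb hab ↦ ?_⟩
  rw [D.frontier_eq_range] at ha hb
  obtain ⟨u₀, rfl⟩ := ha
  obtain ⟨v₀, rfl⟩ := hb
  set u := Int.fract u₀
  set v := Int.fract v₀
  have hu : u ∈ Ico (0 : ℝ) 1 := ⟨Int.fract_nonneg _, Int.fract_lt_one _⟩
  have hv : v ∈ Ico (0 : ℝ) 1 := ⟨Int.fract_nonneg _, Int.fract_lt_one _⟩
  rw [← D.boundary_fract u₀, ← D.boundary_fract v₀] at hab ⊢
  -- conclusion for a parameter `v'` of `b` with `|u - v'| < θ`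
  have conclude : ∀ v' : ℝ, D.boundary v' = D.boundary v → |u - v'| < θ →
      ∃ u' v'' : ℝ, D.boundary u' = D.boundary u ∧ D.boundary v'' = D.boundary v ∧
        |u' - v''| < 1 / 2 ∧ ∀ s ∈ uIcc u' v'', dist (D.boundary s) (D.boundary u) < η := by
    intro v' hv' hlt
    refine ⟨u, v', rfl, hv', hlt.trans_le (min_le_right _ _), fun s hs ↦ ?_⟩
    refine hmod s u ?_
    calc |s - u| ≤ |v' - u| := abs_sub_left_of_mem_uIcc hs
      _ = |u - v'| := abs_sub_comm _ _
      _ < θ₀ := hlt.trans_le (min_le_left _ _)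
  rcases hclose u (Ico_subset_Icc_self hu) v (Ico_subset_Icc_self hv) hab with h | h
  · exact conclude v rfl h
  · have hθle : θ ≤ 1 / 2 := min_le_right _ _
    rcases lt_or_gt_of_ne (show u ≠ v by rintro heq; simp [heq] at h; linarith) with huv | huv
    · refine conclude (v - 1) ?_ ?_
      · have := D.periodic_boundary (v - 1); rw [sub_add_cancel] at this; exact this.symm
      · rw [abs_of_neg (by linarith)] at h
        rw [abs_of_pos (by linarith [hu.1, hv.2])]
        linarith
    · refine conclude (v + 1) (D.periodic_boundary v) ?_
      rw [abs_of_pos (by linarith)] at h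
      rw [abs_of_neg (by linarith [hu.2, hv.1])]
      linarith

end JordanDomain

/-! ### Conformal maps of the disc onto a Jordan domain: crosscuts near a boundary point -/

namespace JordanDomain

open Literature.Analysis.Complex.LengthArea

variable {D : JordanDomain} (φ : ConformalEquiv (ball (0 : ℂ) 1) D.carrier)

/-- The inverse of a conformal equivalence onto an open set is continuous at points of the
target. [folklore] -/
theorem continuousAt_symm {y : ℂ} (hy : y ∈ D.carrier) : ContinuousAt φ.symm y :=
  (φ.symm.continuousOn y hy).continuousAt (D.isOpen.mem_nhds hy)

/-- **Boundary limits are boundary points.** If `g → x` with `‖x‖ = 1` along a filter,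
`g` eventually in the disc, and `φ ∘ g → a`, then `a ∈ ∂D` (were `a ∈ D`, continuity of `φ⁻¹`
at `a` would force `x = φ⁻¹ a ∈ 𝔻`). [folklore] -/
theorem mem_frontier_of_tendsto {ι : Type*} {l : Filter ι} [NeBot l] {g : ι → ℂ}
    (hg : ∀ᶠ t in l, g t ∈ ball (0 : ℂ) 1) {x : ℂ} (hx : ‖x‖ = 1) (hgx : Tendsto g l (𝓝 x))
    {a : ℂ} (ha : Tendsto (fun t ↦ φ (g t)) l (𝓝 a)) : a ∈ frontier D.carrier := by
  have hcl : a ∈ closure D.carrier :=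
    mem_closure_of_tendsto ha (hg.mono fun t ht ↦ φ.mapsTo ht)
  rw [D.closure_eq_union] at hcl
  refine hcl.resolve_left fun haD ↦ ?_
  have h1 : Tendsto (fun t ↦ φ.symm (φ (g t))) l (𝓝 (φ.symm a)) :=
    (continuousAt_symm φ haD).tendsto.comp ha
  have h2 : Tendsto (fun t ↦ φ.symm (φ (g t))) l (𝓝 x) :=
    hgx.congr' (hg.mono fun t ht ↦ (φ.symm_apply_apply ht).symm)
  have := tendsto_nhds_unique h1 h2
  have hmem := φ.symm_mapsTo haD
  rw [this, mem_ball_zero_iff, hx] at hmem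
  exact lt_irrefl _ hmem

variable {ζ : ℂ} {r : ℝ}

/-- At the parameter values `t = ± arccos (r/2)` the circle `ζ - ζ r e^{it}` meets the unit
circle. [folklore] -/
theorem norm_cpt_arccos (hζ : ‖ζ‖ = 1) (hr : r ∈ Ioo (0 : ℝ) 1) (t : ℝ) (ht : |t| = arccos (r / 2)) :
    ‖cpt ζ r t‖ = 1 := by
  have h := norm_cpt_sq hζ r t
  rw [← Real.cos_abs, ht, Real.cos_arccos (by linarith [hr.1]) (by linarith [hr.2])] at h
  nlinarith [norm_nonneg (cpt ζ r t)]

/-- The crosscut parametrisation `t ↦ ζ - ζ r e^{it}` is injective on `(-arccos (r/2), arccos (r/2))`. [folklore] -/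
theorem injOn_cpt (hζ : ‖ζ‖ = 1) (hr : r ∈ Ioo (0 : ℝ) 1) :
    InjOn (cpt ζ r) (Ioo (-arccos (r / 2)) (arccos (r / 2))) := by
  have hζ0 : ζ ≠ 0 := by rintro rfl; simp at hζ
  have hαle : arccos (r / 2) ≤ π / 2 := arccos_le_pi_div_two.2 (by linarith [hr.1])
  intro t ht t' ht' h
  simp only [cpt] at h
  have h1 : exp (t * I) = exp (t' * I) := by
    have hr0 : (r : ℂ) ≠ 0 := ofReal_ne_zero.2 hr.1.ne'
    have := sub_right_injective h
    field_simp at this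
    calc exp (t * I) = exp (I * t') := this
      _ = exp (t' * I) := by rw [mul_comm]
  obtain ⟨n, hn⟩ := Complex.exp_eq_exp_iff_exists_int.1 h1
  have hn' : (t : ℂ) = t' + n * (2 * π) := by
    have hI : (I : ℂ) ≠ 0 := I_ne_zero
    have := mul_right_cancel₀ hI (by rw [hn]; ring : (t : ℂ) * I = (t' + n * (2 * π)) * I)
    exact this
  have hreal : t = t' + n * (2 * π) := by exact_mod_cast hn'
  have habs : |(n : ℝ)| < 1 := by
    have h2 : |t - t'| < 2 * π := by
      rw [abs_sub_lt_iff]; constructor <;> linarith [ht.1, ht.2, ht'.1, ht'.2, Real.pi_pos]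
    rw [hreal, add_sub_cancel_left, abs_mul, abs_of_pos Real.two_pi_pos] at h2
    by_contra hcon
    push Not at hcon
    have : 2 * π ≤ |(n : ℝ)| * (2 * π) := le_mul_of_one_le_left Real.two_pi_pos.le hcon
    linarith
  have hn0 : n = 0 := by
    have : |n| < 1 := by exact_mod_cast habs
    exact Int.abs_lt_one_iff.mp this
  rw [hreal, hn0]; simp

/-- **The crosscut closed up by a short boundary arc is a Jordan curve.** Given the crosscut
`t ↦ φ (ζ - ζ r e^{it})` on `(-α, α)`, `α = arccos (r/2)`, with endpoints `a`, `b ∈ ∂D`, and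
parameters `u`, `v` of `a`, `b` on the boundary loop with `|u - v| < 1/2`, the union `E` of the
closed crosscut and the boundary arc `D.boundary [u, v]` is the range of a continuous
`1`-periodic map injective on a period; `E` consists of the crosscut and points of `∂D`, and lies
in any closed disc about `a` containing the crosscut, `b` and the arc. [folklore] -/
theorem exists_loop (hζ : ‖ζ‖ = 1) (hr : r ∈ Ioo (0 : ℝ) 1) {a b : ℂ}
    (ha : Tendsto (fun t ↦ φ (cpt ζ r t)) (𝓝[>] (-arccos (r / 2))) (𝓝 a))
    (hb : Tendsto (fun t ↦ φ (cpt ζ r t)) (𝓝[<] (arccos (r / 2))) (𝓝 b))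
    {u v : ℝ} (hu : D.boundary u = a) (hv : D.boundary v = b) (huv : |u - v| < 1 / 2)
    {R : ℝ} (hRc : ∀ t ∈ Ioo (-arccos (r / 2)) (arccos (r / 2)), dist (φ (cpt ζ r t)) a ≤ R)
    (hRb : dist a b ≤ R) (hRσ : ∀ s ∈ uIcc u v, dist (D.boundary s) a ≤ R) :
    ∃ E : Set ℂ, (∃ γ : ℝ → ℂ, Continuous γ ∧ γ.Periodic 1 ∧ InjOn γ (Ico 0 1) ∧ range γ = E) ∧
      (fun t ↦ φ (cpt ζ r t)) '' Ioo (-arccos (r / 2)) (arccos (r / 2)) ⊆ E ∧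
      E ⊆ (fun t ↦ φ (cpt ζ r t)) '' Ioo (-arccos (r / 2)) (arccos (r / 2)) ∪ frontier D.carrier ∧
      E ⊆ closedBall a R := by
  set α := arccos (r / 2) with hα
  have hαpos : 0 < α := arccos_pos.2 (by linarith [hr.2])
  have hαpi : α ≤ π := arccos_le_pi _
  set c : ℝ → ℂ := fun t ↦ φ (cpt ζ r t) with hc
  have hmem : ∀ t ∈ Ioo (-α) α, cpt ζ r t ∈ ball (0 : ℂ) 1 := fun t ht ↦ by
    have habs : |t| < α := abs_lt.2 ht
    exact (mem_ball_cpt_iff_abs_lt hζ hr.1 (by linarith [hr.2]) (habs.le.trans hαpi)).2 habs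
  have hcont : ContinuousOn c (Ioo (-α) α) :=
    φ.continuousOn.comp (continuous_cpt ζ r).continuousOn hmem
  -- endpoints are boundary points
  have haJ : a ∈ frontier D.carrier := by
    refine mem_frontier_of_tendsto φ (l := 𝓝[>] (-α)) ?_ (norm_cpt_arccos hζ hr (-α) (by
      rw [abs_neg, abs_of_pos hαpos])) ?_ ha
    · filter_upwards [Ioo_mem_nhdsGT (by linarith : -α < α)] with t ht using hmem t ht
    · exact ((continuous_cpt ζ r).tendsto (-α)).mono_left nhdsWithin_le_nhds
  have hbJ : b ∈ frontier D.carrier := by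
    refine mem_frontier_of_tendsto φ (l := 𝓝[<] α) ?_ (norm_cpt_arccos hζ hr α
      (abs_of_pos hαpos)) ?_ hb
    · filter_upwards [Ioo_mem_nhdsLT (by linarith : -α < α)] with t ht using hmem t ht
    · exact ((continuous_cpt ζ r).tendsto α).mono_left nhdsWithin_le_nhds
  have hcJ : ∀ t ∈ Ioo (-α) α, c t ∈ D.carrier := fun t ht ↦ φ.mapsTo (hmem t ht)
  -- the closed crosscut `P` on `[-α, α]` and its reparametrisation `p` on `[0, 1]`
  set P : ℝ → ℂ := extendFrom (Ioo (-α) α) c with hP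
  have hPc : ContinuousOn P (Icc (-α) α) := continuousOn_Icc_extendFrom_Ioo hcont ha hb
  have hPa : P (-α) = a := eq_lim_at_left_extendFrom_Ioo (by linarith) ha
  have hPb : P α = b := eq_lim_at_right_extendFrom_Ioo (by linarith) hb
  have hPeq : ∀ t ∈ Ioo (-α) α, P t = c t := extendFrom_extends hcont
  set p : ℝ → ℂ := fun s ↦ P (-α + 2 * α * s) with hp
  have hlin : ∀ s ∈ Icc (0 : ℝ) 1, -α + 2 * α * s ∈ Icc (-α) α := fun s hs ↦
    ⟨by nlinarith [hs.1], by nlinarith [hs.2]⟩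
  have hlin' : ∀ s ∈ Ioo (0 : ℝ) 1, -α + 2 * α * s ∈ Ioo (-α) α := fun s hs ↦
    ⟨by nlinarith [hs.1], by nlinarith [hs.2]⟩
  have hpc : ContinuousOn p (Icc 0 1) := hPc.comp (by fun_prop) hlin
  have hp0 : p 0 = a := by simp [hp, hPa]
  have hp1 : p 1 = b := by simp only [hp, mul_one]; rw [show -α + 2 * α = α by ring, hPb]
  have hpint : ∀ s ∈ Ioo (0 : ℝ) 1, p s = c (-α + 2 * α * s) := fun s hs ↦ hPeq _ (hlin' s hs)
  -- images
  have hpimage : p '' Icc 0 1 = c '' Ioo (-α) α ∪ {a, b} := by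
    ext z
    simp only [mem_image, mem_union, mem_insert_iff, mem_singleton_iff]
    constructor
    · rintro ⟨s, hs, rfl⟩
      rcases eq_or_lt_of_le hs.1 with rfl | hs0
      · exact Or.inr (Or.inl hp0)
      rcases eq_or_lt_of_le hs.2 with rfl | hs1
      · exact Or.inr (Or.inr hp1)
      exact Or.inl ⟨_, hlin' s ⟨hs0, hs1⟩, (hpint s ⟨hs0, hs1⟩).symm⟩
    · rintro (⟨t, ht, rfl⟩ | rfl | rfl)
      · refine ⟨(t + α) / (2 * α), ⟨div_nonneg (by linarith [ht.1]) (by linarith), by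
          rw [div_le_one (by positivity)]; linarith [ht.2]⟩, ?_⟩
        have hs : (t + α) / (2 * α) ∈ Ioo (0 : ℝ) 1 :=
          ⟨div_pos (by linarith [ht.1]) (by linarith),
            by rw [div_lt_one (by positivity)]; linarith [ht.2]⟩
        rw [hpint _ hs]; congr 1; field_simp; ring
      · exact ⟨0, ⟨le_rfl, zero_le_one⟩, hp0⟩
      · exact ⟨1, ⟨zero_le_one, le_rfl⟩, hp1⟩
  -- injectivity of `p` on `[0, 1)` (and on `[0, 1]` when `a ≠ b`)
  have hcinj : InjOn c (Ioo (-α) α) := fun t ht t' ht' h ↦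
    injOn_cpt hζ hr ht ht' (φ.injOn (hmem t ht) (hmem t' ht') h)
  have hpinj_aux : ∀ s ∈ Ioo (0 : ℝ) 1, ∀ s' ∈ Ioo (0 : ℝ) 1, p s = p s' → s = s' := by
    intro s hs s' hs' h
    rw [hpint s hs, hpint s' hs'] at h
    have := hcinj (hlin' s hs) (hlin' s' hs') h
    nlinarith
  have hpa_ne : ∀ s ∈ Ioo (0 : ℝ) 1, p s ≠ a := fun s hs h ↦
    D.not_mem_of_mem_frontier haJ (by rw [← h, hpint s hs]; exact hcJ _ (hlin' s hs))
  have hpb_ne : ∀ s ∈ Ioo (0 : ℝ) 1, p s ≠ b := fun s hs h ↦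
    D.not_mem_of_mem_frontier hbJ (by rw [← h, hpint s hs]; exact hcJ _ (hlin' s hs))
  have hpinj : InjOn p (Ico 0 1) := by
    intro s hs s' hs' h
    rcases eq_or_lt_of_le hs.1 with rfl | hs0 <;> rcases eq_or_lt_of_le hs'.1 with h' | hs0'
    · exact h'
    · exact absurd (h.symm.trans hp0) (hpa_ne s' ⟨hs0', hs'.2⟩)
    · subst h'; exact absurd (h.trans hp0) (hpa_ne s ⟨hs0, hs.2⟩)
    · exact hpinj_aux s ⟨hs0, hs.2⟩ s' ⟨hs0', hs'.2⟩ h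
  -- bounds
  have hER : c '' Ioo (-α) α ∪ {a, b} ⊆ closedBall a R := by
    rintro z (⟨t, ht, rfl⟩ | rfl | rfl)
    · exact hRc t ht
    · exact mem_closedBall_self (dist_nonneg.trans hRb)
    · rw [mem_closedBall, dist_comm]; exact hRb
  by_cases hab : a = b
  · -- the crosscut closes up: `E = c (-α, α) ∪ {a}`
    obtain ⟨γ, hγc, hγp, hγi, hγr⟩ := exists_periodic_of_closed_arc hpc hpinj (hp0.trans (hab.trans hp1.symm))
    refine ⟨p '' Icc 0 1, ⟨γ, hγc, hγp, hγi, hγr⟩, ?_, ?_, ?_⟩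
    · rw [hpimage]; exact subset_union_left
    · rw [hpimage]
      refine union_subset_union_right _ ?_
      rintro z (rfl | rfl); exacts [haJ, hbJ]
    · rwa [hpimage]
  · -- close up by the boundary arc `q` from `b` to `a`
    set q : ℝ → ℂ := fun s ↦ D.boundary (v + s * (u - v)) with hq
    have hqc : ContinuousOn q (Icc 0 1) := by
      have := D.continuous_boundary
      exact Continuous.continuousOn (by fun_prop)
    have hq0 : q 0 = b := by simp [hq, hv]
    have hq1 : q 1 = a := by simp [hq, hu]
    have huv_ne : u ≠ v := fun h ↦ hab (by rw [← hu, ← hv, h])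
    have hparam : ∀ s ∈ Icc (0 : ℝ) 1, v + s * (u - v) ∈ uIcc u v := by
      intro s hs
      rcases le_total u v with h | h
      · rw [uIcc_of_le h]; exact ⟨by nlinarith [hs.1, hs.2], by nlinarith [hs.1, hs.2]⟩
      · rw [uIcc_of_ge h]; exact ⟨by nlinarith [hs.1, hs.2], by nlinarith [hs.1, hs.2]⟩
    have hqinj : InjOn q (Icc 0 1) := by
      intro s hs s' hs' h
      have := D.injOn_boundary_uIcc (huv.trans (by norm_num)) (hparam s hs) (hparam s' hs') h
      have h2 : (s - s') * (u - v) = 0 := by linarith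
      rcases mul_eq_zero.1 h2 with h3 | h3
      · linarith
      · exact absurd (sub_eq_zero.1 h3) huv_ne
    have hqJ : ∀ s, q s ∈ frontier D.carrier := fun s ↦ D.boundary_mem_frontier _
    have hpinj' : InjOn p (Icc 0 1) := by
      intro s hs s' hs' h
      rcases eq_or_lt_of_le hs.2 with rfl | hs1 <;> rcases eq_or_lt_of_le hs'.2 with h' | hs1'
      · exact h'.symm
      · rw [hp1] at h
        rcases eq_or_lt_of_le hs'.1 with h'' | hs0'
        · rw [← h'', hp0] at h; exact absurd h.symm hab
        · exact absurd h.symm (hpb_ne s' ⟨hs0', hs1'⟩)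
      · subst h'; rw [hp1] at h
        rcases eq_or_lt_of_le hs.1 with h'' | hs0
        · rw [← h'', hp0] at h; exact absurd h hab
        · exact absurd h (hpb_ne s ⟨hs0, hs1⟩)
      · exact hpinj ⟨hs.1, hs1⟩ ⟨hs'.1, hs1'⟩ h
    have hqp : ∀ s ∈ Ioo (0 : ℝ) 1, ∀ s' ∈ Icc (0 : ℝ) 1, q s ≠ p s' := by
      intro s hs s' hs' h
      rcases eq_or_lt_of_le hs'.1 with h' | hs0'
      · -- `q s = a = q 1`
        rw [← h', hp0, ← hq1] at h
        have := hqinj (Ioo_subset_Icc_self hs) ⟨zero_le_one, le_rfl⟩ h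
        linarith [hs.2]
      rcases eq_or_lt_of_le hs'.2 with h' | hs1'
      · -- `q s = b = q 0`
        rw [h', hp1, ← hq0] at h
        have := hqinj (Ioo_subset_Icc_self hs) ⟨le_rfl, zero_le_one⟩ h
        linarith [hs.1]
      · exact D.not_mem_of_mem_frontier (hqJ s) (by
          rw [h, hpint s' ⟨hs0', hs1'⟩]; exact hcJ _ (hlin' s' ⟨hs0', hs1'⟩))
    obtain ⟨γ, hγc, hγp, hγi, hγr⟩ :=
      exists_periodic_of_two_arcs hpc hqc hpinj' hqinj (hp1.trans hq0.symm) (hq1.trans hp0.symm) hqp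
    refine ⟨p '' Icc 0 1 ∪ q '' Icc 0 1, ⟨γ, hγc, hγp, hγi, hγr⟩, ?_, ?_, ?_⟩
    · rw [hpimage]; exact subset_union_left.trans subset_union_left
    · rw [hpimage]
      refine union_subset (union_subset_union_right _ ?_) ?_
      · rintro z (rfl | rfl); exacts [haJ, hbJ]
      · rintro z ⟨s, -, rfl⟩; exact Or.inr (hqJ s)
    · rw [hpimage]
      refine union_subset hER ?_
      rintro z ⟨s, hs, rfl⟩
      exact hRσ _ (hparam s hs)

/-- The part of the unit disc outside a closed disc about a boundary point `ζ` is preconnected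
(it is the union of the circular arcs `𝔻 ∩ {|w - ζ| = s}`, `s > r`, each meeting the diameter
through `ζ`). [folklore] -/
theorem isPreconnected_ball_diff_closedBall (hζ : ‖ζ‖ = 1) (hr : r ∈ Ioo (0 : ℝ) 1) :
    IsPreconnected (ball (0 : ℂ) 1 \ closedBall ζ r) := by
  set S := ball (0 : ℂ) 1 \ closedBall ζ r with hS
  -- the diameter segment `L = {x ζ : -1 < x < 1 - r}`
  set L : Set ℂ := (fun x : ℝ ↦ (x : ℂ) * ζ) '' Ioo (-1) (1 - r) with hL
  have hLS : L ⊆ S := by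
    rintro z ⟨x, hx, rfl⟩
    refine ⟨?_, ?_⟩
    · rw [mem_ball_zero_iff, norm_mul, hζ, mul_one, Complex.norm_real, Real.norm_eq_abs, abs_lt]
      exact ⟨hx.1, by linarith [hx.2, hr.1]⟩
    · rw [mem_closedBall, dist_eq_norm, show (x : ℂ) * ζ - ζ = (x - 1 : ℝ) * ζ by push_cast; ring,
        norm_mul, hζ, mul_one, Complex.norm_real, Real.norm_eq_abs, abs_of_neg (by linarith [hx.2, hr.1])]
      linarith [hx.2]
  have hLc : IsPreconnected L := (isPreconnected_Ioo).image _ (by fun_prop)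
  refine isPreconnected_of_forall (0 : ℂ) fun y hy ↦ ?_
  have hy1 : ‖y‖ < 1 := mem_ball_zero_iff.1 hy.1
  set s := ‖y - ζ‖ with hs
  have hsr : r < s := by
    have := hy.2; rwa [mem_closedBall, dist_eq_norm, not_le] at this
  have hs0 : 0 < s := hr.1.trans hsr
  have hs2 : s < 2 := by
    calc s ≤ ‖y‖ + ‖ζ‖ := norm_sub_le _ _
      _ < 1 + 1 := by rw [hζ]; linarith
      _ = 2 := by norm_num
  obtain ⟨t, ht, hyt⟩ := exists_eq_cpt hζ hs0 rfl
  set β := arccos (s / 2) with hβ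
  have hβpi : β ≤ π := arccos_le_pi _
  have htβ : |t| < β := by
    have habs : |t| ≤ π := abs_le.2 ⟨ht.1.le, ht.2⟩
    have := (mem_ball_cpt_iff_abs_lt hζ hs0 hs2.le habs).1 (by rw [← hyt]; exact hy.1)
    exact this
  -- the arc through `y`
  set A : Set ℂ := cpt ζ s '' Ioo (-β) β with hA
  have hAS : A ⊆ S := by
    rintro z ⟨t', ht', rfl⟩
    have habs : |t'| < β := abs_lt.2 ht'
    refine ⟨(mem_ball_cpt_iff_abs_lt hζ hs0 hs2.le (habs.le.trans hβpi)).2 habs, ?_⟩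
    rw [mem_closedBall, dist_eq_norm, norm_cpt_sub hζ, abs_of_pos hs0, not_le]
    exact hsr
  have hAc : IsPreconnected A := (isPreconnected_Ioo).image _ (continuous_cpt ζ s).continuousOn
  have hyA : y ∈ A := ⟨t, abs_lt.1 htβ, hyt.symm⟩
  -- common point `(1 - s) ζ`
  have hcommon_A : ((1 - s : ℝ) : ℂ) * ζ ∈ A := by
    refine ⟨0, ⟨by linarith [abs_nonneg t, htβ], by linarith [abs_nonneg t, htβ]⟩, ?_⟩
    simp [cpt]; ring
  have hcommon_L : ((1 - s : ℝ) : ℂ) * ζ ∈ L := ⟨1 - s, ⟨by linarith, by linarith⟩, rfl⟩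
  have h0L : (0 : ℂ) ∈ L := ⟨0, ⟨by norm_num, by linarith [hr.2]⟩, by simp⟩
  refine ⟨A ∪ L, union_subset hAS hLS, Or.inr h0L, Or.inl hyA, ?_⟩
  exact IsPreconnected.union _ hcommon_A hcommon_L hAc hLc

/-- The bounded complementary component of a compact set contained in a closed disc lies in that
disc: the exterior `{R < dist z a}` is connected, unbounded and misses the set. [folklore] -/
theorem subset_closedBall_of_isBounded {E U V : Set ℂ} {a : ℂ} {R : ℝ} (hE : E ⊆ closedBall a R)
    (hUo : IsOpen U) (hVo : IsOpen V) (hUV : Disjoint U V) (hunion : U ∪ V = Eᶜ)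
    (hU : Bornology.IsBounded U) (hR : 0 ≤ R) : U ⊆ closedBall a R := by
  intro z hz
  by_contra hzR
  set A : Set ℂ := {w | R < dist w a} with hA
  have hAconn : IsPreconnected A := by
    have h := (Literature.Topology.PlaneTopology.isConnected_setOf_lt_norm hR).isPreconnected.image (fun w ↦ a + w)
      (by fun_prop)
    convert h using 1
    ext w
    simp only [hA, mem_setOf_eq, mem_image, dist_eq_norm]
    constructor
    · intro hw; exact ⟨w - a, hw, by ring⟩
    · rintro ⟨w', hw', rfl⟩; simpa using hw'
  have hAE : A ⊆ U ∪ V := by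
    rw [hunion]
    intro w hw hwE
    exact absurd (hE hwE) (by rw [mem_closedBall]; exact not_le.2 hw)
  have hAunb : ¬ Bornology.IsBounded A := by
    intro h
    have hsub : {w : ℂ | R + ‖a‖ < ‖w‖} ⊆ A := fun w hw ↦ by
      simp only [hA, mem_setOf_eq, dist_eq_norm] at hw ⊢
      have := norm_sub_norm_le w a
      linarith
    exact Literature.Topology.PlaneTopology.not_isBounded_setOf_lt_norm _ (h.subset hsub)
  rcases hAconn.subset_or_subset hUo hVo hUV hAE with h | h
  · exact hAunb (hU.subset h)
  · have hzA : z ∈ A := by rw [mem_closedBall, not_le] at hzR; exact hzR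
    exact Set.disjoint_left.1 hUV hz (h hzA)

end JordanDomain

namespace JordanDomain

open Literature.Analysis.Complex.LengthArea

variable {D : JordanDomain} (φ : ConformalEquiv (ball (0 : ℂ) 1) D.carrier) {ζ : ℂ} {r : ℝ}

/-- The image of the disc under `φ` is the (bounded) Jordan domain. [folklore] -/
theorem image_ball_eq : φ '' ball 0 1 = D.carrier := φ.bijOn.image_eq

/-- Points of the disc at distance exactly `r` from `ζ` are on the crosscut. [folklore] -/
theorem mem_crosscut (hζ : ‖ζ‖ = 1) (hr : r ∈ Ioo (0 : ℝ) 1) {x : ℂ} (hx : x ∈ ball (0 : ℂ) 1)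
    (hxr : ‖x - ζ‖ = r) :
    φ x ∈ (fun t ↦ φ (cpt ζ r t)) '' Ioo (-arccos (r / 2)) (arccos (r / 2)) := by
  obtain ⟨t, ht, rfl⟩ := exists_eq_cpt hζ hr.1 hxr
  have habs : |t| ≤ π := abs_le.2 ⟨ht.1.le, ht.2⟩
  have := (mem_ball_cpt_iff_abs_lt hζ hr.1 (by linarith [hr.2]) habs).1 hx
  exact ⟨t, abs_lt.1 this, rfl⟩

/-- The endpoints of a crosscut are boundary points. [folklore] -/
theorem endpoints_mem_frontier (hζ : ‖ζ‖ = 1) (hr : r ∈ Ioo (0 : ℝ) 1) {a b : ℂ}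
    (ha : Tendsto (fun t ↦ φ (cpt ζ r t)) (𝓝[>] (-arccos (r / 2))) (𝓝 a))
    (hb : Tendsto (fun t ↦ φ (cpt ζ r t)) (𝓝[<] (arccos (r / 2))) (𝓝 b)) :
    a ∈ frontier D.carrier ∧ b ∈ frontier D.carrier := by
  set α := arccos (r / 2) with hα
  have hαpos : 0 < α := arccos_pos.2 (by linarith [hr.2])
  have hαpi : α ≤ π := arccos_le_pi _
  have hmem : ∀ t ∈ Ioo (-α) α, cpt ζ r t ∈ ball (0 : ℂ) 1 := fun t ht ↦ by
    have habs : |t| < α := abs_lt.2 ht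
    exact (mem_ball_cpt_iff_abs_lt hζ hr.1 (by linarith [hr.2]) (habs.le.trans hαpi)).2 habs
  constructor
  · refine mem_frontier_of_tendsto φ (l := 𝓝[>] (-α)) ?_ (norm_cpt_arccos hζ hr (-α) (by
      rw [abs_neg, abs_of_pos hαpos])) ?_ ha
    · filter_upwards [Ioo_mem_nhdsGT (by linarith : -α < α)] with t ht using hmem t ht
    · exact ((continuous_cpt ζ r).tendsto (-α)).mono_left nhdsWithin_le_nhds
  · refine mem_frontier_of_tendsto φ (l := 𝓝[<] α) ?_ (norm_cpt_arccos hζ hr α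
      (abs_of_pos hαpos)) ?_ hb
    · filter_upwards [Ioo_mem_nhdsLT (by linarith : -α < α)] with t ht using hmem t ht
    · exact ((continuous_cpt ζ r).tendsto α).mono_left nhdsWithin_le_nhds

/-- **The near side of a short crosscut is small.** With the notation of `exists_loop`, if
moreover `φ 0` is at distance `> R` from `a`, then `φ` maps `𝔻 ∩ {|w - ζ| < r}` into the closed
disc of radius `R` about `a`. Proof: by the Jordan curve theorem the loop `E` has a bounded and
an unbounded complementary component; the connected sets `φ (𝔻 ∩ {|w - ζ| < r})` and
`φ (𝔻 ∩ {|w - ζ| > r})` miss `E`, and lie in different components because a point of the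
crosscut is a frontier point of the bounded component all of whose nearby points off `E` belong
to one of the two sets; the far side contains `φ 0`, which is not in the bounded component
(contained in the disc of radius `R` about `a`), so the near side is in the bounded component.
[folklore] -/
theorem image_inter_ball_subset (hJ : Literature.Topology.PlaneTopology.JordanCurveTheorem) (hζ : ‖ζ‖ = 1) (hr : r ∈ Ioo (0 : ℝ) 1)
    {a b : ℂ} (ha : Tendsto (fun t ↦ φ (cpt ζ r t)) (𝓝[>] (-arccos (r / 2))) (𝓝 a))
    (hb : Tendsto (fun t ↦ φ (cpt ζ r t)) (𝓝[<] (arccos (r / 2))) (𝓝 b))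
    {u v : ℝ} (hu : D.boundary u = a) (hv : D.boundary v = b) (huv : |u - v| < 1 / 2)
    {R : ℝ} (hRc : ∀ t ∈ Ioo (-arccos (r / 2)) (arccos (r / 2)), dist (φ (cpt ζ r t)) a ≤ R)
    (hRb : dist a b ≤ R) (hRσ : ∀ s ∈ uIcc u v, dist (D.boundary s) a ≤ R)
    (hfar : R < dist (φ 0) a) :
    φ '' (ball 0 1 ∩ ball ζ r) ⊆ closedBall a R := by
  set α := arccos (r / 2) with hα
  have hαpos : 0 < α := arccos_pos.2 (by linarith [hr.2])
  have hR0 : 0 ≤ R := dist_nonneg.trans hRb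
  set c : ℝ → ℂ := fun t ↦ φ (cpt ζ r t) with hc
  obtain ⟨E, ⟨γ, hγc, hγp, hγi, hγr⟩, hcE, hEsub, hER⟩ :=
    exists_loop φ hζ hr ha hb hu hv huv hRc hRb hRσ
  obtain ⟨U₁, U₂, hU₁o, hU₂o, -, -, hdisj, hunion, hfr₁, -, hU₁b, -⟩ :=
    hJ.of_periodic hγc hγp hγi
  rw [hγr] at hunion hfr₁
  have hU₁R : U₁ ⊆ closedBall a R :=
    subset_closedBall_of_isBounded hER hU₁o hU₂o hdisj hunion hU₁b hR0
  set W₁ := φ '' (ball 0 1 ∩ ball ζ r) with hW₁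
  set W₂ := φ '' (ball 0 1 \ closedBall ζ r) with hW₂
  have hmem : ∀ t ∈ Ioo (-α) α, cpt ζ r t ∈ ball (0 : ℂ) 1 := fun t ht ↦ by
    have habs : |t| < α := abs_lt.2 ht
    exact (mem_ball_cpt_iff_abs_lt hζ hr.1 (by linarith [hr.2])
      (habs.le.trans (arccos_le_pi _))).2 habs
  -- `W₁`, `W₂` miss `E`
  have hnotE : ∀ x ∈ ball (0 : ℂ) 1, ‖x - ζ‖ ≠ r → φ x ∉ E := by
    intro x hx hxr hxE
    rcases hEsub hxE with ⟨t, ht, hct⟩ | hJ'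
    · have := φ.injOn (hmem t ht) hx hct
      rw [← this, norm_cpt_sub hζ, abs_of_pos hr.1] at hxr
      exact hxr rfl
    · exact D.not_mem_of_mem_frontier hJ' (φ.mapsTo hx)
  have hW₁E : W₁ ⊆ U₁ ∪ U₂ := by
    rw [hunion]
    rintro _ ⟨x, ⟨hx, hxr⟩, rfl⟩
    exact hnotE x hx (by rw [mem_ball, dist_eq_norm] at hxr; exact hxr.ne)
  have hW₂E : W₂ ⊆ U₁ ∪ U₂ := by
    rw [hunion]
    rintro _ ⟨x, ⟨hx, hxr⟩, rfl⟩
    exact hnotE x hx (by rw [mem_closedBall, dist_eq_norm, not_le] at hxr; exact hxr.ne')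
  have hW₁c : IsPreconnected W₁ :=
    ((convex_ball 0 1).inter (convex_ball ζ r)).isPreconnected.image _
      (φ.continuousOn.mono inter_subset_left)
  have hW₂c : IsPreconnected W₂ :=
    (isPreconnected_ball_diff_closedBall hζ hr).image _ (φ.continuousOn.mono fun _ hx ↦ hx.1)
  have h1 := hW₁c.subset_or_subset hU₁o hU₂o hdisj hW₁E
  have h2 := hW₂c.subset_or_subset hU₁o hU₂o hdisj hW₂E
  -- a point `y₁ ∈ U₁` near the crosscut point `z₀ = φ (cpt ζ r 0)` lies in `W₁ ∪ W₂`
  have h0mem : (0 : ℝ) ∈ Ioo (-α) α := ⟨by linarith, hαpos⟩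
  set z₀ := c 0 with hz₀
  have hz₀E : z₀ ∈ E := hcE ⟨0, h0mem, rfl⟩
  have hz₀Ω : z₀ ∈ D.carrier := φ.mapsTo (hmem 0 h0mem)
  obtain ⟨δ, hδ, hballΩ⟩ := Metric.isOpen_iff.1 D.isOpen z₀ hz₀Ω
  have hcover : ∀ y ∈ ball z₀ δ, y ∉ E → y ∈ W₁ ∪ W₂ := by
    intro y hy hyE
    have hyΩ : y ∈ φ '' ball 0 1 := by rw [image_ball_eq]; exact hballΩ hy
    obtain ⟨x, hx, rfl⟩ := hyΩ
    rcases lt_trichotomy ‖x - ζ‖ r with hlt | heq | hgt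
    · exact Or.inl ⟨x, ⟨hx, by rwa [mem_ball, dist_eq_norm]⟩, rfl⟩
    · exact absurd (hcE (mem_crosscut φ hζ hr hx heq)) hyE
    · exact Or.inr ⟨x, ⟨hx, by rwa [mem_closedBall, dist_eq_norm, not_le]⟩, rfl⟩
  have hz₀fr : z₀ ∈ frontier U₁ := by rw [hfr₁]; exact hz₀E
  obtain ⟨y₁, hy₁U, hy₁d⟩ := Metric.mem_closure_iff.1 (frontier_subset_closure hz₀fr) δ hδ
  have hy₁E : y₁ ∉ E := fun h ↦ by
    have : y₁ ∈ U₁ ∪ U₂ := Or.inl hy₁U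
    rw [hunion] at this; exact this h
  have hy₁W := hcover y₁ (mem_ball'.2 hy₁d) hy₁E
  have h0W₂ : φ 0 ∈ W₂ := ⟨0, ⟨mem_ball_self one_pos, by
    rw [mem_closedBall, dist_eq_norm, zero_sub, norm_neg, hζ, not_le]; exact hr.2⟩, rfl⟩
  rcases h1 with h1 | h1
  · exact h1.trans hU₁R
  · rcases h2 with h2 | h2
    · exact absurd (hU₁R (h2 h0W₂)) (by rw [mem_closedBall]; exact not_le.2 hfar)
    · exfalso
      have : y₁ ∈ U₂ := hy₁W.elim (fun h ↦ h1 h) (fun h ↦ h2 h)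
      exact Set.disjoint_left.1 hdisj hy₁U this

/-- **Equicontinuity at a boundary point** (the heart of Carathéodory's theorem): for every
`ε₀ > 0` there is `ρ > 0` such that `φ` oscillates by less than `ε₀` on `𝔻 ∩ {|w - ζ| < ρ}`.
Combine the short crosscut of the length–area lemma, the short boundary arc joining its
endpoints, and `image_inter_ball_subset`. [folklore] -/
theorem exists_forall_dist_lt (hJ : Literature.Topology.PlaneTopology.JordanCurveTheorem) (hζ : ‖ζ‖ = 1) {ε₀ : ℝ} (hε₀ : 0 < ε₀) :
    ∃ ρ > 0, ∀ z ∈ ball (0 : ℂ) 1, dist z ζ < ρ → ∀ z' ∈ ball (0 : ℂ) 1, dist z' ζ < ρ →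
      dist (φ z) (φ z') < ε₀ := by
  -- `φ 0` is at positive distance `d₀` from `∂D`
  obtain ⟨d₀, hd₀, hballΩ⟩ := Metric.isOpen_iff.1 D.isOpen (φ 0) (φ.mapsTo (mem_ball_self one_pos))
  have hfarJ : ∀ a ∈ frontier D.carrier, d₀ ≤ dist (φ 0) a := fun a ha ↦ by
    by_contra h
    exact D.not_mem_of_mem_frontier ha (hballΩ (by rw [mem_ball']; exact not_le.1 h))
  set η := min (ε₀ / 4) (d₀ / 2) with hη
  have hηpos : 0 < η := lt_min (by linarith) (by linarith)
  obtain ⟨ε₁, hε₁, harc⟩ := D.exists_short_arc hηpos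
  set ε := min (ε₁ / 2) η with hε
  have hεpos : 0 < ε := lt_min (by linarith) hηpos
  have hbdd : Bornology.IsBounded (φ '' ball 0 1) := by rw [image_ball_eq]; exact D.isBounded
  obtain ⟨r, hr, -, a, b, ha, hb, hRc, hRb⟩ :=
    exists_short_crosscut_of_isBounded φ.differentiableOn φ.injOn hbdd hζ hεpos
  obtain ⟨haJ, hbJ⟩ := endpoints_mem_frontier φ hζ hr ha hb
  obtain ⟨u, v, hu, hv, huv, hσ⟩ := harc a haJ b hbJ (hRb.trans_lt (by
    calc ε ≤ ε₁ / 2 := min_le_left _ _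
      _ < ε₁ := by linarith))
  have hεη : ε ≤ η := min_le_right _ _
  have hW := image_inter_ball_subset φ hJ hζ hr ha hb hu hv huv (R := η)
    (fun t ht ↦ (hRc t ht).trans hεη) (hRb.trans hεη) (fun s hs ↦ (hσ s hs).le) (by
      calc η ≤ d₀ / 2 := min_le_right _ _
        _ < d₀ := by linarith
        _ ≤ dist (φ 0) a := hfarJ a haJ)
  refine ⟨r, hr.1, fun z hz hzr z' hz' hz'r ↦ ?_⟩
  have h1 : φ z ∈ closedBall a η := hW ⟨z, ⟨hz, hzr⟩, rfl⟩
  have h2 : φ z' ∈ closedBall a η := hW ⟨z', ⟨hz', hz'r⟩, rfl⟩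
  rw [mem_closedBall] at h1 h2
  calc dist (φ z) (φ z') ≤ dist (φ z) a + dist (φ z') a := dist_triangle_right _ _ _
    _ ≤ η + η := add_le_add h1 h2
    _ ≤ ε₀ / 4 + ε₀ / 4 := add_le_add (min_le_left _ _) (min_le_left _ _)
    _ < ε₀ := by linarith

/-- `φ` has a limit at every point of the unit circle from within the disc. [folklore] -/
theorem exists_tendsto_of_norm_eq_one (hJ : Literature.Topology.PlaneTopology.JordanCurveTheorem) (hζ : ‖ζ‖ = 1) :
    ∃ y, Tendsto φ (𝓝[ball 0 1] ζ) (𝓝 y) := by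
  have hζcl : ζ ∈ closure (ball (0 : ℂ) 1) := by
    rw [closure_ball 0 one_ne_zero, mem_closedBall_zero_iff, hζ]
  haveI : NeBot (𝓝[ball (0 : ℂ) 1] ζ) := mem_closure_iff_nhdsWithin_neBot.1 hζcl
  have hC : Cauchy (map φ (𝓝[ball (0 : ℂ) 1] ζ)) := by
    rw [Metric.cauchy_iff]
    refine ⟨inferInstance, fun ε hε ↦ ?_⟩
    obtain ⟨ρ, hρ, h⟩ := exists_forall_dist_lt φ hJ hζ hε
    refine ⟨φ '' (ball 0 1 ∩ ball ζ ρ), image_mem_map (inter_mem_nhdsWithin _ (ball_mem_nhds ζ hρ)),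
      ?_⟩
    rintro _ ⟨z, ⟨hz, hzρ⟩, rfl⟩ _ ⟨z', ⟨hz', hz'ρ⟩, rfl⟩
    exact h z hz hzρ z' hz' hz'ρ
  obtain ⟨y, hy⟩ := CompleteSpace.complete hC
  exact ⟨y, hy⟩

end JordanDomain

/-! ### The Carathéodory extension -/

namespace JordanDomain

open Literature.Analysis.Complex.LengthArea

variable {D : JordanDomain} (φ : ConformalEquiv (ball (0 : ℂ) 1) D.carrier)

/-- `φ` has a limit within the disc at every point of the closed disc. [folklore] -/
theorem exists_tendsto_of_mem_closedBall (hJ : Literature.Topology.PlaneTopology.JordanCurveTheorem) {x : ℂ}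
    (hx : x ∈ closedBall (0 : ℂ) 1) : ∃ y, Tendsto φ (𝓝[ball 0 1] x) (𝓝 y) := by
  rcases eq_or_lt_of_le (mem_closedBall_zero_iff.1 hx) with h | h
  · exact exists_tendsto_of_norm_eq_one φ hJ h
  · exact ⟨φ x, φ.continuousOn x (mem_ball_zero_iff.2 h)⟩

/-- **Carathéodory extension, continuity.** `extendFrom 𝔻 φ` is continuous on the closed disc
(Pommerenke (1992), Thm. 2.6, continuity part; from the Jordan curve theorem). [cite: PommerenkeBBCM1992, Thm. 2.6] -/
theorem continuousOn_extendFrom (hJ : Literature.Topology.PlaneTopology.JordanCurveTheorem) :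
    ContinuousOn (extendFrom (ball 0 1) φ) (closedBall (0 : ℂ) 1) :=
  _root_.continuousOn_extendFrom (by rw [closure_ball 0 one_ne_zero])
    fun _ hx ↦ exists_tendsto_of_mem_closedBall φ hJ hx

/-- The extension agrees with `φ` on the open disc. [folklore] -/
theorem extendFrom_eq {x : ℂ} (hx : x ∈ ball (0 : ℂ) 1) : extendFrom (ball 0 1) φ x = φ x :=
  extendFrom_extends φ.continuousOn x hx

/-- The extension is the limit of `φ` at every point of the closed disc. [folklore] -/
theorem tendsto_extendFrom (hJ : Literature.Topology.PlaneTopology.JordanCurveTheorem) {x : ℂ} (hx : x ∈ closedBall (0 : ℂ) 1) :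
    Tendsto φ (𝓝[ball 0 1] x) (𝓝 (extendFrom (ball 0 1) φ x)) :=
  _root_.tendsto_extendFrom (exists_tendsto_of_mem_closedBall φ hJ hx)

/-- Points of the closed disc are limit points of the open disc. [folklore] -/
theorem neBot_nhdsWithin_ball {x : ℂ} (hx : x ∈ closedBall (0 : ℂ) 1) :
    NeBot (𝓝[ball (0 : ℂ) 1] x) := by
  refine mem_closure_iff_nhdsWithin_neBot.1 ?_
  rwa [closure_ball 0 one_ne_zero]

/-- The extension maps the closed disc into `closure D`. [folklore] -/
theorem extendFrom_mem_closure (hJ : Literature.Topology.PlaneTopology.JordanCurveTheorem) {x : ℂ} (hx : x ∈ closedBall (0 : ℂ) 1) :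
    extendFrom (ball 0 1) φ x ∈ closure D.carrier := by
  haveI := neBot_nhdsWithin_ball hx
  exact mem_closure_of_tendsto (tendsto_extendFrom φ hJ hx)
    (eventually_mem_nhdsWithin.mono fun z hz ↦ φ.mapsTo hz)

/-- The extension maps the unit circle into `∂D`. [folklore] -/
theorem extendFrom_mem_frontier (hJ : Literature.Topology.PlaneTopology.JordanCurveTheorem) {x : ℂ} (hx : ‖x‖ = 1) :
    extendFrom (ball 0 1) φ x ∈ frontier D.carrier := by
  have hx' : x ∈ closedBall (0 : ℂ) 1 := mem_closedBall_zero_iff.2 hx.le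
  haveI := neBot_nhdsWithin_ball hx'
  exact mem_frontier_of_tendsto φ (l := 𝓝[ball (0 : ℂ) 1] x) (g := id) eventually_mem_nhdsWithin
    hx (tendsto_id.mono_left nhdsWithin_le_nhds) (tendsto_extendFrom φ hJ hx')

/-- The extension maps the closed disc onto `closure D`. [folklore] -/
theorem surjOn_extendFrom (hJ : Literature.Topology.PlaneTopology.JordanCurveTheorem) :
    SurjOn (extendFrom (ball 0 1) φ) (closedBall (0 : ℂ) 1) (closure D.carrier) := by
  have hK : IsCompact (extendFrom (ball 0 1) φ '' closedBall (0 : ℂ) 1) :=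
    (isCompact_closedBall 0 1).image_of_continuousOn (continuousOn_extendFrom φ hJ)
  have hΩ : D.carrier ⊆ extendFrom (ball 0 1) φ '' closedBall (0 : ℂ) 1 := by
    intro y hy
    have hy' : y ∈ φ '' ball 0 1 := by rw [image_ball_eq φ]; exact hy
    obtain ⟨x, hx, rfl⟩ := hy'
    exact ⟨x, ball_subset_closedBall hx, extendFrom_eq φ hx⟩
  exact hK.isClosed.closure_subset_iff.2 hΩ

/-- The extension maps the unit circle onto `∂D`. [folklore] -/
theorem surjOn_extendFrom_sphere (hJ : Literature.Topology.PlaneTopology.JordanCurveTheorem) :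
    SurjOn (extendFrom (ball 0 1) φ) (sphere (0 : ℂ) 1) (frontier D.carrier) := by
  intro y hy
  obtain ⟨x, hx, rfl⟩ := surjOn_extendFrom φ hJ (frontier_subset_closure hy)
  rcases eq_or_lt_of_le (mem_closedBall_zero_iff.1 hx) with h | h
  · exact ⟨x, mem_sphere_zero_iff_norm.2 h, rfl⟩
  · exfalso
    rw [extendFrom_eq φ (mem_ball_zero_iff.2 h)] at hy
    exact D.not_mem_of_mem_frontier hy (φ.mapsTo (mem_ball_zero_iff.2 h))

end JordanDomain

/-! ### Angles, sectors and arcs of the unit disc -/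

section Sectors

/-- `exp (t i) = exp (t' i)` with `|t - t'| < 2π` forces `t = t'`. [folklore] -/
theorem eq_of_exp_mul_I_eq {t t' : ℝ} (h : exp (t * I) = exp (t' * I)) (hlt : |t - t'| < 2 * π) :
    t = t' := by
  obtain ⟨n, hn⟩ := Complex.exp_eq_exp_iff_exists_int.1 h
  have hn' : (t : ℂ) = t' + n * (2 * π) := by
    have := mul_right_cancel₀ I_ne_zero (by rw [hn]; ring : (t : ℂ) * I = (t' + n * (2 * π)) * I)
    exact this
  have hreal : t = t' + n * (2 * π) := by exact_mod_cast hn'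
  have habs : |(n : ℝ)| < 1 := by
    rw [hreal, add_sub_cancel_left, abs_mul, abs_of_pos Real.two_pi_pos] at hlt
    by_contra hcon
    push Not at hcon
    have : 2 * π ≤ |(n : ℝ)| * (2 * π) := le_mul_of_one_le_left Real.two_pi_pos.le hcon
    linarith
  have hn0 : n = 0 := by
    have : |n| < 1 := by exact_mod_cast habs
    exact Int.abs_lt_one_iff.mp this
  rw [hreal, hn0]; simp

/-- `exp (t i) = exp (s i)` for the representative `t = toIocMod 2π a s ∈ (a, a + 2π]`. [folklore] -/
theorem exp_toIocMod_mul_I (a s : ℝ) : exp ((toIocMod Real.two_pi_pos a s : ℝ) * I) = exp (s * I) := by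
  rw [← self_sub_toIocDiv_zsmul Real.two_pi_pos a s, zsmul_eq_mul]
  push_cast
  rw [sub_mul, Complex.exp_sub, show ((toIocDiv Real.two_pi_pos a s : ℤ) : ℂ) * (2 * π) * I
    = (toIocDiv Real.two_pi_pos a s : ℤ) * (2 * π * I) by ring, exp_int_mul_two_pi_mul_I, div_one]

/-- A nonzero `z` is `‖z‖ exp (t i)` for `t = toIocMod 2π a (arg z) ∈ (a, a + 2π]`. [folklore] -/
theorem eq_norm_mul_exp_toIocMod (a : ℝ) (z : ℂ) :
    z = (‖z‖ : ℂ) * exp ((toIocMod Real.two_pi_pos a (arg z) : ℝ) * I) := by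
  rw [exp_toIocMod_mul_I, norm_mul_exp_arg_mul_I]

/-- Two distinct points of the unit circle are `exp (θ₁ i)`, `exp (θ₂ i)` with
`θ₁ < θ₂ < θ₁ + 2π`. [folklore] -/
theorem exists_angles {x x' : ℂ} (hx : ‖x‖ = 1) (hx' : ‖x'‖ = 1) (hne : x ≠ x') :
    ∃ θ₁ θ₂ : ℝ, x = exp (θ₁ * I) ∧ x' = exp (θ₂ * I) ∧ θ₁ < θ₂ ∧ θ₂ < θ₁ + 2 * π := by
  set θ₁ := arg x
  set θ₂ := toIocMod Real.two_pi_pos θ₁ (arg x')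
  have h1 : x = exp (θ₁ * I) := by
    have := norm_mul_exp_arg_mul_I x; rw [hx, ofReal_one, one_mul] at this; exact this.symm
  have h2 : x' = exp (θ₂ * I) := by
    have := eq_norm_mul_exp_toIocMod θ₁ x'; rwa [hx', ofReal_one, one_mul] at this
  have hmem := toIocMod_mem_Ioc Real.two_pi_pos θ₁ (arg x')
  refine ⟨θ₁, θ₂, h1, h2, hmem.1, lt_of_le_of_ne hmem.2 fun heq ↦ hne ?_⟩
  rw [h1, h2, heq, ofReal_add, add_mul, Complex.exp_add]
  push_cast
  rw [show (2 : ℂ) * π * I = (1 : ℤ) * (2 * π * I) by simp, exp_int_mul_two_pi_mul_I, mul_one]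

/-- The open sector `{ρ e^{it} : 0 < ρ < 1, θa < t < θb}` of the unit disc. [folklore] -/
def sector (θa θb : ℝ) : Set ℂ :=
  (fun p : ℝ × ℝ ↦ (p.1 : ℂ) * exp (p.2 * I)) '' Ioo (0 : ℝ) 1 ×ˢ Ioo θa θb

variable {θa θb : ℝ}

/-- Sectors are preconnected. [folklore] -/
theorem isPreconnected_sector : IsPreconnected (sector θa θb) :=
  (isPreconnected_Ioo.prod isPreconnected_Ioo).image _ (by fun_prop)

/-- Sectors lie in the unit disc. [folklore] -/
theorem sector_subset_ball : sector θa θb ⊆ ball (0 : ℂ) 1 := by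
  rintro _ ⟨⟨ρ, t⟩, ⟨hρ, -⟩, rfl⟩
  rw [mem_ball_zero_iff, norm_mul, norm_exp_ofReal_mul_I, mul_one, Complex.norm_real,
    Real.norm_eq_abs, abs_of_pos hρ.1]
  exact hρ.2

/-- A radius `{s e^{iθ₀} : s ≥ 0}` misses the sector `(θa, θb)` when no `t ∈ (θa, θb)` is
congruent to `θ₀` (here: `t ≠ θ₀` and `|t - θ₀| < 2π`). [folklore] -/
theorem radius_not_mem_sector {θ₀ : ℝ} (h : ∀ t ∈ Ioo θa θb, t ≠ θ₀ ∧ |t - θ₀| < 2 * π) {s : ℝ}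
    (hs : 0 ≤ s) : (s : ℂ) * exp (θ₀ * I) ∉ sector θa θb := by
  rintro ⟨⟨ρ, t⟩, ⟨hρ, ht⟩, heq⟩
  simp only at heq
  have hnorm : ρ = s := by
    have := congrArg norm heq
    simpa [norm_exp_ofReal_mul_I, abs_of_pos hρ.1, abs_of_nonneg hs] using this
  subst hnorm
  have := mul_left_cancel₀ (ofReal_ne_zero.2 hρ.1.ne') heq
  obtain ⟨hne, hlt⟩ := h t ht
  exact hne (eq_of_exp_mul_I_eq this hlt)

/-- `φ 0 ∉` sector: sectors miss the origin. [folklore] -/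
theorem zero_not_mem_sector : (0 : ℂ) ∉ sector θa θb := by
  rintro ⟨⟨ρ, t⟩, ⟨hρ, -⟩, heq⟩
  simp only [mul_eq_zero, ofReal_eq_zero, Complex.exp_ne_zero, or_false] at heq
  exact hρ.1.ne' heq

/-- **Covering by two sectors.** For `θ₁ < θ₂ < θ₁ + 2π`, a nonzero point of the disc off the two
radii at angles `θ₁`, `θ₂` lies in one of the two sectors `(θ₁, θ₂)`, `(θ₂, θ₁ + 2π)`. [folklore] -/
theorem mem_sector_or {θ₁ θ₂ : ℝ} {z : ℂ} (hz : z ∈ ball (0 : ℂ) 1) (hz0 : z ≠ 0)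
    (h1 : z ≠ (‖z‖ : ℂ) * exp (θ₁ * I)) (h2 : z ≠ (‖z‖ : ℂ) * exp (θ₂ * I)) :
    z ∈ sector θ₁ θ₂ ∪ sector θ₂ (θ₁ + 2 * π) := by
  set t := toIocMod Real.two_pi_pos θ₁ (arg z) with ht
  have hzt : z = (‖z‖ : ℂ) * exp (t * I) := eq_norm_mul_exp_toIocMod θ₁ z
  have hmem := toIocMod_mem_Ioc Real.two_pi_pos θ₁ (arg z)
  have hρ : ‖z‖ ∈ Ioo (0 : ℝ) 1 := ⟨norm_pos_iff.2 hz0, mem_ball_zero_iff.1 hz⟩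
  have ht1 : t ≠ θ₁ + 2 * π := fun heq ↦ h1 (by
    conv_lhs => rw [hzt, heq]
    congr 1
    rw [ofReal_add, add_mul, Complex.exp_add]
    push_cast
    rw [show (2 : ℂ) * π * I = (1 : ℤ) * (2 * π * I) by simp, exp_int_mul_two_pi_mul_I, mul_one])
  have ht2 : t ≠ θ₂ := fun heq ↦ h2 (by conv_lhs => rw [hzt, heq])
  rcases lt_or_gt_of_ne ht2 with hlt | hgt
  · exact Or.inl ⟨(‖z‖, t), ⟨hρ, hmem.1, hlt⟩, hzt.symm⟩
  · exact Or.inr ⟨(‖z‖, t), ⟨hρ, hgt, lt_of_le_of_ne hmem.2 ht1⟩, hzt.symm⟩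

/-- **An open set cutting out an arc.** For `θa < θb` there is an open set `U` meeting the unit
circle, such that every point of the unit circle in `U` is `exp (t i)` with `t ∈ (θa, θb)`. [folklore] -/
theorem exists_isOpen_arc (hab : θa < θb) :
    ∃ U : Set ℂ, IsOpen U ∧ (sphere (0 : ℂ) 1 ∩ U).Nonempty ∧
      ∀ z ∈ sphere (0 : ℂ) 1 ∩ U, ∃ t ∈ Ioo θa θb, z = exp (t * I) := by
  set θm := (θa + θb) / 2 with hθm
  set hw := (θb - θa) / 2 with hhw
  have hhw0 : 0 < hw := by rw [hhw]; linarith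
  set V : Set ℂ := slitPlane ∩ arg ⁻¹' Ioo (-hw) hw with hV
  have hVo : IsOpen V := by
    refine ContinuousOn.isOpen_inter_preimage (fun v hv ↦ (continuousAt_arg hv).continuousWithinAt)
      isOpen_slitPlane isOpen_Ioo
  set U : Set ℂ := (fun z ↦ z * exp (-(θm * I))) ⁻¹' V with hU
  have hUo : IsOpen U := hVo.preimage (by fun_prop)
  have hexp : exp (θm * I) * exp (-(θm * I)) = 1 := by rw [← Complex.exp_add, add_neg_cancel, Complex.exp_zero]
  refine ⟨U, hUo, ⟨exp (θm * I), by simp [norm_exp_ofReal_mul_I], ?_⟩, ?_⟩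
  · show exp (θm * I) * exp (-(θm * I)) ∈ V
    rw [hexp]
    exact ⟨one_mem_slitPlane, by simp [hhw0]⟩
  · rintro z ⟨hz, hzU⟩
    set v := z * exp (-(θm * I)) with hv
    obtain ⟨hvs, hva⟩ : v ∈ V := hzU
    have hv1 : ‖v‖ = 1 := by
      rw [hv, norm_mul, mem_sphere_zero_iff_norm.1 hz, one_mul, show -(θm * I) = ((-θm : ℝ) : ℂ) * I by
        push_cast; ring, norm_exp_ofReal_mul_I]
    have hveq : v = exp (arg v * I) := by
      have := norm_mul_exp_arg_mul_I v; rw [hv1, ofReal_one, one_mul] at this; exact this.symm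
    refine ⟨θm + arg v, ⟨?_, ?_⟩, ?_⟩
    · have := hva.1; rw [hθm, hhw] at *; linarith
    · have := hva.2; rw [hθm, hhw] at *; linarith
    · calc z = v * exp (θm * I) := by
            rw [hv, mul_assoc, ← Complex.exp_add, neg_add_cancel, Complex.exp_zero, mul_one]
        _ = exp ((θm + arg v : ℝ) * I) := by
            conv_lhs => rw [hveq]
            rw [← Complex.exp_add]; congr 1; push_cast; ring

end Sectors


/-! ### Injectivity of the extension and Carathéodory's theorem -/

namespace JordanDomain

open Literature.Analysis.Complex.LengthArea

variable {D : JordanDomain} (φ : ConformalEquiv (ball (0 : ℂ) 1) D.carrier)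

/-- Radial limits of the extension: `Φ (ρ e) → Φ e` as `ρ → 1⁻` (`‖e‖ = 1`). [folklore] -/
theorem tendsto_extendFrom_radial (hJ : Literature.Topology.PlaneTopology.JordanCurveTheorem) {e : ℂ} (he : ‖e‖ = 1) :
    Tendsto (fun ρ : ℝ ↦ extendFrom (ball 0 1) φ ((ρ : ℂ) * e)) (𝓝[<] 1)
      (𝓝 (extendFrom (ball 0 1) φ e)) := by
  have hcont := (continuousOn_extendFrom φ hJ) e (mem_closedBall_zero_iff.2 he.le)
  have hpath : Tendsto (fun ρ : ℝ ↦ (ρ : ℂ) * e) (𝓝[<] 1) (𝓝[closedBall (0 : ℂ) 1] e) := by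
    refine tendsto_nhdsWithin_iff.2 ⟨?_, ?_⟩
    · have : Tendsto (fun ρ : ℝ ↦ (ρ : ℂ) * e) (𝓝 1) (𝓝 ((1 : ℝ) * e)) :=
        ((continuous_ofReal.tendsto 1).mul tendsto_const_nhds)
      rw [ofReal_one, one_mul] at this
      exact this.mono_left nhdsWithin_le_nhds
    · filter_upwards [Ioo_mem_nhdsLT one_pos] with ρ hρ
      rw [mem_closedBall_zero_iff, norm_mul, he, mul_one, Complex.norm_real, Real.norm_eq_abs,
        abs_of_pos hρ.1]
      exact hρ.2.le
  exact hcont.tendsto.comp hpath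

/-- **Carathéodory extension, injectivity on the circle.** Two distinct points of the unit
circle have distinct images. Otherwise, with `w` the common image, the images of the two radii
form a Jordan curve `E'` through `w`; one of the two sectors of the disc is mapped into the
bounded component of `ℂ ∖ E'` (frontier argument at an interior point of a radius), whose
closure meets `∂D` only in `w` (the exterior of `D` is connected, unbounded and accumulates at
every point of `∂D`); hence the extension is constantly `w` on an arc of the circle, and the
boundary uniqueness theorem forces `φ ≡ w`, absurd. [folklore] -/
theorem injOn_extendFrom_sphere (hJ : Literature.Topology.PlaneTopology.JordanCurveTheorem) :
    InjOn (extendFrom (ball 0 1) φ) (sphere (0 : ℂ) 1) := by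
  set Φ := extendFrom (ball 0 1) φ with hΦ
  intro x hx x' hx' hw
  by_contra hne
  have hx1 : ‖x‖ = 1 := mem_sphere_zero_iff_norm.1 hx
  have hx1' : ‖x'‖ = 1 := mem_sphere_zero_iff_norm.1 hx'
  set w := Φ x with hwdef
  have hwJ : w ∈ frontier D.carrier := extendFrom_mem_frontier φ hJ hx1
  have hΦc := continuousOn_extendFrom φ hJ
  obtain ⟨θ₁, θ₂, hxθ, hx'θ, h12, h21⟩ := exists_angles hx1 hx1' hne
  -- membership of radial points
  have hrad : ∀ {e : ℂ}, ‖e‖ = 1 → ∀ s ∈ Ico (0 : ℝ) 1, (s : ℂ) * e ∈ ball (0 : ℂ) 1 := by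
    intro e he s hs
    rw [mem_ball_zero_iff, norm_mul, he, mul_one, Complex.norm_real, Real.norm_eq_abs,
      abs_of_nonneg hs.1]
    exact hs.2
  have hrad' : ∀ {e : ℂ}, ‖e‖ = 1 → ∀ s ∈ Icc (0 : ℝ) 1, (s : ℂ) * e ∈ closedBall (0 : ℂ) 1 := by
    intro e he s hs
    rw [mem_closedBall_zero_iff, norm_mul, he, mul_one, Complex.norm_real, Real.norm_eq_abs,
      abs_of_nonneg hs.1]
    exact hs.2
  -- the two radii `p` (from `φ 0` to `w` along `x`) and `q` (from `w` to `φ 0` along `x'`)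
  set p : ℝ → ℂ := fun s ↦ Φ ((s : ℂ) * x) with hp
  set q : ℝ → ℂ := fun s ↦ Φ (((1 - s : ℝ) : ℂ) * x') with hq
  have hpc : ContinuousOn p (Icc 0 1) := hΦc.comp (by fun_prop) (hrad' hx1)
  have hqc : ContinuousOn q (Icc 0 1) :=
    hΦc.comp (by fun_prop) fun s hs ↦ hrad' hx1' (1 - s) ⟨by linarith [hs.2], by linarith [hs.1]⟩
  have hp_lt : ∀ s ∈ Ico (0 : ℝ) 1, p s = φ ((s : ℂ) * x) := fun s hs ↦
    extendFrom_eq φ (hrad hx1 s hs)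
  have hq_gt : ∀ s ∈ Ioc (0 : ℝ) 1, q s = φ (((1 - s : ℝ) : ℂ) * x') := fun s hs ↦
    extendFrom_eq φ (hrad hx1' (1 - s) ⟨by linarith [hs.2], by linarith [hs.1]⟩)
  have hΦ0 : Φ 0 = φ 0 := extendFrom_eq φ (mem_ball_self one_pos)
  have hp1 : p 1 = w := by simp [hp, hwdef]
  have hq0 : q 0 = w := by simp only [hq, sub_zero, ofReal_one, one_mul]; exact hw.symm
  have hp0 : p 0 = φ 0 := by simp only [hp, ofReal_zero, zero_mul]; exact hΦ0
  have hq1 : q 1 = φ 0 := by simp only [hq, sub_self, ofReal_zero, zero_mul]; exact hΦ0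
  have hpΩ : ∀ s ∈ Ico (0 : ℝ) 1, p s ∈ D.carrier := fun s hs ↦ by
    rw [hp_lt s hs]; exact φ.mapsTo (hrad hx1 s hs)
  have hqΩ : ∀ s ∈ Ioc (0 : ℝ) 1, q s ∈ D.carrier := fun s hs ↦ by
    rw [hq_gt s hs]; exact φ.mapsTo (hrad hx1' (1 - s) ⟨by linarith [hs.2], by linarith [hs.1]⟩)
  have hwΩ : w ∉ D.carrier := D.not_mem_of_mem_frontier hwJ
  have hx0 : x ≠ 0 := by rintro rfl; simp at hx1
  have hx0' : x' ≠ 0 := by rintro rfl; simp at hx1'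
  -- injectivity of the radii
  have hpinj : InjOn p (Icc 0 1) := by
    intro s hs s' hs' h
    rcases eq_or_lt_of_le hs.2 with rfl | hs1 <;> rcases eq_or_lt_of_le hs'.2 with h' | hs1'
    · exact h'.symm
    · exact absurd (hpΩ s' ⟨hs'.1, hs1'⟩) (by rw [← h, hp1]; exact hwΩ)
    · exact absurd (hpΩ s ⟨hs.1, hs1⟩) (by rw [h, h', hp1]; exact hwΩ)
    · rw [hp_lt s ⟨hs.1, hs1⟩, hp_lt s' ⟨hs'.1, hs1'⟩] at h
      have := φ.injOn (hrad hx1 s ⟨hs.1, hs1⟩) (hrad hx1 s' ⟨hs'.1, hs1'⟩) h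
      exact_mod_cast mul_right_cancel₀ hx0 this
  have hqinj : InjOn q (Icc 0 1) := by
    intro s hs s' hs' h
    rcases eq_or_lt_of_le hs.1 with h0 | hs0 <;> rcases eq_or_lt_of_le hs'.1 with h0' | hs0'
    · rw [← h0, ← h0']
    · exact absurd (hqΩ s' ⟨hs0', hs'.2⟩) (by rw [← h, ← h0, hq0]; exact hwΩ)
    · exact absurd (hqΩ s ⟨hs0, hs.2⟩) (by rw [h, ← h0', hq0]; exact hwΩ)
    · rw [hq_gt s ⟨hs0, hs.2⟩, hq_gt s' ⟨hs0', hs'.2⟩] at h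
      have := φ.injOn (hrad hx1' (1 - s) ⟨by linarith [hs.2], by linarith⟩)
        (hrad hx1' (1 - s') ⟨by linarith [hs'.2], by linarith⟩) h
      have := mul_right_cancel₀ hx0' this
      have : (1 - s : ℝ) = 1 - s' := by exact_mod_cast this
      linarith
  -- interior points of `q` are off `p`
  have hqp : ∀ s ∈ Ioo (0 : ℝ) 1, ∀ s' ∈ Icc (0 : ℝ) 1, q s ≠ p s' := by
    intro s hs s' hs' h
    rcases eq_or_lt_of_le hs'.2 with h1 | hs1'
    · exact hwΩ (by rw [← hp1, ← h1, ← h]; exact hqΩ s ⟨hs.1, hs.2.le⟩)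
    · rw [hq_gt s ⟨hs.1, hs.2.le⟩, hp_lt s' ⟨hs'.1, hs1'⟩] at h
      have heq := φ.injOn (hrad hx1' (1 - s) ⟨by linarith [hs.2], by linarith [hs.1]⟩)
        (hrad hx1 s' ⟨hs'.1, hs1'⟩) h
      have hn := congrArg norm heq
      simp only [norm_mul, Complex.norm_real, Real.norm_eq_abs, hx1, hx1', mul_one,
        abs_of_pos (by linarith [hs.2] : (0 : ℝ) < 1 - s), abs_of_nonneg hs'.1] at hn
      rw [hn] at heq
      have hs'0 : (s' : ℂ) ≠ 0 := ofReal_ne_zero.2 (by linarith [hs.2])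
      exact hne (mul_left_cancel₀ hs'0 heq).symm
  -- the Jordan curve `E' = p [0,1] ∪ q [0,1]` and its complementary components
  obtain ⟨γ, hγc, hγp, hγi, hγr⟩ :=
    exists_periodic_of_two_arcs hpc hqc hpinj hqinj (hp1.trans hq0.symm) (hq1.trans hp0.symm) hqp
  obtain ⟨U₁, U₂, hU₁o, hU₂o, -, -, hdisj, hunion, hfr₁, hfr₂, hU₁b, -⟩ :=
    hJ.of_periodic hγc hγp hγi
  rw [hγr] at hunion hfr₁ hfr₂
  set E := p '' Icc 0 1 ∪ q '' Icc 0 1 with hE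
  have hEsub : E ⊆ D.carrier ∪ {w} := by
    rintro z (⟨s, hs, rfl⟩ | ⟨s, hs, rfl⟩)
    · rcases eq_or_lt_of_le hs.2 with rfl | hs1
      · exact Or.inr hp1
      · exact Or.inl (hpΩ s ⟨hs.1, hs1⟩)
    · rcases eq_or_lt_of_le hs.1 with h0 | hs0
      · exact Or.inr (by rw [← h0]; exact hq0)
      · exact Or.inl (hqΩ s ⟨hs0, hs.2⟩)
  -- the exterior of `D` lies in the unbounded component; `∂D` misses the bounded component
  obtain ⟨hXc, hXfr⟩ := D.isConnected_compl_closure hJ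
  have hXE : (closure D.carrier)ᶜ ⊆ U₁ ∪ U₂ := by
    rw [hunion]
    intro z hz hzE
    rcases hEsub hzE with h | h
    · exact hz (subset_closure h)
    · exact hz (by rw [mem_singleton_iff.1 h]; exact frontier_subset_closure hwJ)
  have hXU₂ : (closure D.carrier)ᶜ ⊆ U₂ := by
    rcases hXc.isPreconnected.subset_or_subset hU₁o hU₂o hdisj hXE with h | h
    · exact absurd (hU₁b.subset h) D.not_isBounded_compl_closure
    · exact h
  have hJU₁ : ∀ y ∈ frontier D.carrier, y ∉ U₁ := by
    intro y hy hyU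
    have hycl : y ∈ closure (closure D.carrier)ᶜ := by
      rw [← hXfr] at hy; exact frontier_subset_closure hy
    obtain ⟨z, hzU, hzX⟩ := mem_closure_iff_nhds.1 hycl U₁ (hU₁o.mem_nhds hyU)
    exact Set.disjoint_left.1 hdisj hzU (hXU₂ hzX)
  -- the two sectors miss `E`
  have hsecE : ∀ {θa θb : ℝ}, (∀ t ∈ Ioo θa θb, (t ≠ θ₁ ∧ |t - θ₁| < 2 * π) ∧
      (t ≠ θ₂ ∧ |t - θ₂| < 2 * π)) → φ '' sector θa θb ⊆ U₁ ∪ U₂ := by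
    intro θa θb hθ
    rw [hunion]
    rintro _ ⟨z, hz, rfl⟩ hzE
    have hzb : z ∈ ball (0 : ℂ) 1 := sector_subset_ball hz
    rcases hzE with ⟨s, hs, hps⟩ | ⟨s, hs, hqs⟩
    · rcases eq_or_lt_of_le hs.2 with rfl | hs1
      · exact hwΩ (by rw [← hp1, hps]; exact φ.mapsTo hzb)
      · rw [hp_lt s ⟨hs.1, hs1⟩] at hps
        have := φ.injOn (hrad hx1 s ⟨hs.1, hs1⟩) hzb hps
        rw [hxθ] at this
        exact radius_not_mem_sector (fun t ht ↦ (hθ t ht).1) hs.1 (this ▸ hz)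
    · rcases eq_or_lt_of_le hs.1 with h0 | hs0
      · exact hwΩ (by rw [← hq0, h0, hqs]; exact φ.mapsTo hzb)
      · rw [hq_gt s ⟨hs0, hs.2⟩] at hqs
        have := φ.injOn (hrad hx1' (1 - s) ⟨by linarith [hs.2], by linarith⟩) hzb hqs
        rw [hx'θ] at this
        exact radius_not_mem_sector (fun t ht ↦ (hθ t ht).2) (by linarith [hs.2]) (this ▸ hz)
  have hθS₁ : ∀ t ∈ Ioo θ₁ θ₂, (t ≠ θ₁ ∧ |t - θ₁| < 2 * π) ∧ (t ≠ θ₂ ∧ |t - θ₂| < 2 * π) :=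
    fun t ht ↦ ⟨⟨ht.1.ne', by rw [abs_sub_lt_iff]; constructor <;> linarith [ht.1, ht.2]⟩,
      ⟨ht.2.ne, by rw [abs_sub_lt_iff]; constructor <;> linarith [ht.1, ht.2, Real.pi_pos]⟩⟩
  have hθS₂ : ∀ t ∈ Ioo θ₂ (θ₁ + 2 * π), (t ≠ θ₁ ∧ |t - θ₁| < 2 * π) ∧
      (t ≠ θ₂ ∧ |t - θ₂| < 2 * π) :=
    fun t ht ↦ ⟨⟨by linarith [ht.1], by rw [abs_sub_lt_iff]; constructor <;> linarith [ht.1, ht.2]⟩,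
      ⟨ht.1.ne', by rw [abs_sub_lt_iff]; constructor <;> linarith [ht.1, ht.2]⟩⟩
  have hS₁ := (isPreconnected_sector.image _ (φ.continuousOn.mono sector_subset_ball)).subset_or_subset
    hU₁o hU₂o hdisj (hsecE hθS₁)
  have hS₂ := (isPreconnected_sector.image _ (φ.continuousOn.mono sector_subset_ball)).subset_or_subset
    hU₁o hU₂o hdisj (hsecE hθS₂)
  -- frontier argument at `z₁ = p (1/2) = φ (x/2)`
  have hhalf : (1 / 2 : ℝ) ∈ Ico (0 : ℝ) 1 := ⟨by norm_num, by norm_num⟩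
  set z₁ := p (1 / 2) with hz₁
  have hz₁E : z₁ ∈ E := Or.inl ⟨1 / 2, ⟨by norm_num, by norm_num⟩, rfl⟩
  have hz₁Ω : z₁ ∈ D.carrier := hpΩ _ hhalf
  obtain ⟨δ, hδ, hballΩ⟩ := Metric.isOpen_iff.1 D.isOpen z₁ hz₁Ω
  have hcover : ∀ y ∈ ball z₁ δ, y ∉ E → y ∈ φ '' sector θ₁ θ₂ ∪ φ '' sector θ₂ (θ₁ + 2 * π) := by
    intro y hy hyE
    have hyΩ : y ∈ φ '' ball 0 1 := by rw [image_ball_eq]; exact hballΩ hy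
    obtain ⟨z, hz, rfl⟩ := hyΩ
    have hz0 : z ≠ 0 := by
      rintro rfl
      exact hyE (Or.inl ⟨0, ⟨le_rfl, zero_le_one⟩, hp0⟩)
    have hzn : ‖z‖ ∈ Ioo (0 : ℝ) 1 := ⟨norm_pos_iff.2 hz0, mem_ball_zero_iff.1 hz⟩
    have h1 : z ≠ (‖z‖ : ℂ) * exp (θ₁ * I) := fun heq ↦ hyE (Or.inl ⟨‖z‖, ⟨hzn.1.le, hzn.2.le⟩, by
      rw [hp_lt _ ⟨hzn.1.le, hzn.2⟩, hxθ, ← heq]⟩)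
    have h2 : z ≠ (‖z‖ : ℂ) * exp (θ₂ * I) := fun heq ↦ hyE (Or.inr ⟨1 - ‖z‖,
      ⟨by linarith [hzn.2], by linarith [hzn.1]⟩, by
        rw [hq_gt _ ⟨by linarith [hzn.2], by linarith [hzn.1]⟩, hx'θ, sub_sub_cancel, ← heq]⟩)
    rcases mem_sector_or hz hz0 h1 h2 with h | h
    · exact Or.inl ⟨z, h, rfl⟩
    · exact Or.inr ⟨z, h, rfl⟩
  have hz₁fr : z₁ ∈ frontier U₁ := by rw [hfr₁]; exact hz₁E
  have hz₁fr' : z₁ ∈ frontier U₂ := by rw [hfr₂]; exact hz₁E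
  obtain ⟨y₁, hy₁U, hy₁d⟩ := Metric.mem_closure_iff.1 (frontier_subset_closure hz₁fr) δ hδ
  obtain ⟨y₂, hy₂U, hy₂d⟩ := Metric.mem_closure_iff.1 (frontier_subset_closure hz₁fr') δ hδ
  have hnotE : ∀ y ∈ U₁ ∪ U₂, y ∉ E := fun y hy hyE ↦ by rw [hunion] at hy; exact hy hyE
  have hy₁S := hcover y₁ (mem_ball'.2 hy₁d) (hnotE y₁ (Or.inl hy₁U))
  have hy₂S := hcover y₂ (mem_ball'.2 hy₂d) (hnotE y₂ (Or.inr hy₂U))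
  -- one of the two sectors is mapped into the bounded component `U₁`
  have hsome : ∃ θa θb : ℝ, θa < θb ∧
      (∀ t ∈ Ioo θa θb, (t ≠ θ₁ ∧ |t - θ₁| < 2 * π) ∧ (t ≠ θ₂ ∧ |t - θ₂| < 2 * π)) ∧
      φ '' sector θa θb ⊆ U₁ := by
    rcases hS₁ with h1 | h1
    · exact ⟨θ₁, θ₂, h12, hθS₁, h1⟩
    rcases hS₂ with h2 | h2
    · exact ⟨θ₂, θ₁ + 2 * π, h21, hθS₂, h2⟩
    exfalso
    have : y₁ ∈ U₂ := hy₁S.elim (fun h ↦ h1 h) (fun h ↦ h2 h)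
    exact Set.disjoint_left.1 hdisj hy₁U this
  clear hy₂S hy₂d hy₂U y₂
  obtain ⟨θa, θb, hab, hθ, hSU⟩ := hsome
  -- the extension is `w` on the arc `(θa, θb)`
  have harc : ∀ t ∈ Ioo θa θb, Φ (exp (t * I)) = w := by
    intro t ht
    have he : ‖exp (t * I)‖ = 1 := norm_exp_ofReal_mul_I t
    have hlim := tendsto_extendFrom_radial φ hJ he
    have hcl : Φ (exp (t * I)) ∈ closure U₁ := by
      refine mem_closure_of_tendsto hlim ?_
      filter_upwards [Ioo_mem_nhdsLT one_pos] with ρ hρ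
      have hmem : (ρ : ℂ) * exp (t * I) ∈ sector θa θb := ⟨(ρ, t), ⟨hρ, ht⟩, rfl⟩
      have : Φ ((ρ : ℂ) * exp (t * I)) = φ ((ρ : ℂ) * exp (t * I)) :=
        extendFrom_eq φ (sector_subset_ball hmem)
      have hmemU : φ ((ρ : ℂ) * exp (t * I)) ∈ U₁ := hSU ⟨_, hmem, rfl⟩
      rw [← this] at hmemU
      exact hmemU
    have hJ' : Φ (exp (t * I)) ∈ frontier D.carrier := extendFrom_mem_frontier φ hJ he
    rw [closure_eq_self_union_frontier, hfr₁] at hcl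
    rcases hcl with h | h
    · exact absurd h (hJU₁ _ hJ')
    · rcases hEsub h with h' | h'
      · exact absurd h' (D.not_mem_of_mem_frontier hJ')
      · exact h'
  -- boundary uniqueness: `Φ - w` vanishes on an arc, hence `φ 0 = w`, absurd
  obtain ⟨U, hUo, hUne, hUarc⟩ := exists_isOpen_arc hab
  have hdc : DiffContOnCl ℂ (fun z ↦ Φ z - w) (ball (0 : ℂ) 1) := by
    refine DiffContOnCl.sub ⟨?_, ?_⟩ diffContOnCl_const
    · exact φ.differentiableOn.congr fun z hz ↦ extendFrom_eq φ hz
    · rw [closure_ball 0 one_ne_zero]; exact hΦc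
  have hzero := Complex.eqOn_zero_of_diffContOnCl_ball_of_eqOn_arc hdc hUo hUne (fun z hz ↦ by
    obtain ⟨t, ht, rfl⟩ := hUarc z hz
    simp only [harc t ht, sub_self])
  have h0 : Φ 0 - w = 0 := hzero (mem_closedBall_self zero_le_one)
  rw [hΦ0, sub_eq_zero] at h0
  exact hwΩ (h0 ▸ φ.mapsTo (mem_ball_self one_pos))

/-- **Carathéodory extension, injectivity on the closed disc** (Pommerenke (1992), Thm. 2.6,
injectivity part; from the Jordan curve theorem). [cite: PommerenkeBBCM1992, Thm. 2.6] -/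
theorem injOn_extendFrom (hJ : Literature.Topology.PlaneTopology.JordanCurveTheorem) :
    InjOn (extendFrom (ball 0 1) φ) (closedBall (0 : ℂ) 1) := by
  intro x hx x' hx' h
  have key : ∀ y ∈ ball (0 : ℂ) 1, ∀ y', ‖y'‖ = 1 → extendFrom (ball 0 1) φ y ≠ extendFrom (ball 0 1) φ y' := by
    intro y hy y' hy' heq
    rw [extendFrom_eq φ hy] at heq
    exact D.not_mem_of_mem_frontier (heq ▸ extendFrom_mem_frontier φ hJ hy') (φ.mapsTo hy)
  rcases eq_or_lt_of_le (mem_closedBall_zero_iff.1 hx) with h1 | h1 <;>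
    rcases eq_or_lt_of_le (mem_closedBall_zero_iff.1 hx') with h1' | h1'
  · exact injOn_extendFrom_sphere φ hJ (mem_sphere_zero_iff_norm.2 h1) (mem_sphere_zero_iff_norm.2 h1') h
  · exact absurd h.symm (key x' (mem_ball_zero_iff.2 h1') x h1)
  · exact absurd h (key x (mem_ball_zero_iff.2 h1) x' h1')
  · rw [extendFrom_eq φ (mem_ball_zero_iff.2 h1), extendFrom_eq φ (mem_ball_zero_iff.2 h1')] at h
    exact φ.injOn (mem_ball_zero_iff.2 h1) (mem_ball_zero_iff.2 h1') h

/-- **Carathéodory's theorem for Jordan domains, from the Jordan curve theorem.** Assuming the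
Jordan curve theorem (`Literature.Topology.PlaneTopology.JordanCurveTheorem`, McCleary (2006), Ch. 9), every conformal
equivalence of the unit disc onto a Jordan domain extends continuously to the closed disc, the
extension being a bijection of the closed disc onto the closure of the domain which maps the
unit circle bijectively onto the boundary curve: the disc form
`Literature.Probability.RandomPlanarGeometry.JordanDomain.exists_continuousOn_extension` (Pommerenke, *Boundary Behaviour of Conformal
Maps* (1992), Thm. 2.6; Garnett–Marshall, *Harmonic Measure* (2005), Thm. I.3.1). [cite: PommerenkeBBCM1992, Thm. 2.6] -/
theorem exists_continuousOn_extension_of_jordanCurveTheorem (hJ : Literature.Topology.PlaneTopology.JordanCurveTheorem) :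
    exists_continuousOn_extension := by
  intro D φ
  refine ⟨extendFrom (ball 0 1) φ, continuousOn_extendFrom φ hJ, fun x hx ↦ extendFrom_eq φ hx,
    ⟨fun x hx ↦ extendFrom_mem_closure φ hJ hx, injOn_extendFrom φ hJ, surjOn_extendFrom φ hJ⟩,
    ⟨fun x hx ↦ extendFrom_mem_frontier φ hJ (mem_sphere_zero_iff_norm.1 hx),
      (injOn_extendFrom φ hJ).mono sphere_subset_closedBall, surjOn_extendFrom_sphere φ hJ⟩⟩

end JordanDomain

end Literature.Probability.RandomPlanarGeometry
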